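import Literature.MathematicalPhysics.QuantumFieldTheory.Balaban1983to89.HiggsCondGauss228
import Literature.MathematicalPhysics.QuantumFieldTheory.Balaban1983to89.B1Ineq233Upper
import Literature.MathematicalPhysics.QuantumFieldTheory.Balaban1983to89.B4Sect5Torus

/-!
# `Balaban1983to89.B1Ineq234Concrete` — T. Bałaban, *(Higgs)₂,₃ quantum fields in a finite volume. I. A lower bound*,
# Commun. Math. Phys. **85** (1982) 603–626 [Balaban1982Higgs1], Proposition 2.3 pp. 611–612: the kernel bounds
# **(2.34)** `|C^{(k)}_Λ(Ω,A;x,x′)| ≤ c₀e^{−δ₀|x−x′|}`, **(2.36)** `|δC^{(k)}_Λ(Ω,A;x,x′)| ≤ c₀e^{−δ₀(|x−x′|+dist(x,Λᶜ)+dist(x′,Λᶜ))}`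
# and the shape of **(2.38)** FOR THE CONCRETE CONDITIONAL COVARIANCES `HiggsCondCov232.condCov232` / `deltaCov235`
# of the (Higgs)₂,₃ model, DERIVED — for every level, every `Λ`, every `Ω`, `A`, volume — from the two-sided input
# (5.6) of the printed route of [Balaban1983RegularityDecay] p. 594 (*"Proposition I.2.3 is a consequence of the
# following Theorem"*), the Theorem itself being the kernel-proved engine `B4Sect5Torus.sect5_uniform`

statement-level skeleton of published theorems with citation tags; proofs where landed; nothing here is a claim about the Yang–Mills mass gap

PDF held: `paper:balaban1982-cmp85-higgs23-i` (journal page = PDF page + 602), pp. 604, 611–612 [PDF 2, 9–10] read on the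
×2 renders `run/shared/lean/pub/pub-balaban/b2b-balaban-ref1/pages/1982-cmp85-higgs23-I/1982-cmp85-higgs23-I-p002|p009|p010-x2.png`;
companion `paper:balaban1983-cmp89-regularity-decay` (journal page = PDF page + 570), pp. 593–594 [PDF 23–24].

CITATION HEADER (lean-in-tree rule).  Cell `lit-balaban` (HOME `run/shared/lean/pub/lit-balaban/`), seat **r14** gen 7
(reader/typer of B1/B2, fold owner of SKELETON row **B1.Prop2.3**; unit `lit-balaban-r14-g7`).  WHAT IS REPRODUCED: row
B1.Prop2.3, members (2.34)–(2.36) (+ the shape of (2.37)–(2.38)), kind «printed route on the concrete carrier»: the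
decls of record `B1.Prop23Literal` / `B1.Prop23Intended` (pv07, over b04's abstract `B4.UnitSetting`) are UNTOUCHED; the
model instances of the whole Proposition live in `B4Ineq118Torus` (A = 0, torus, pv07) and `B4Prop23RegularFamily`
(A ≠ 0, nested block unions of ℤ^d, p17); r01's `B4Prop23Sect5Route` runs the same printed route over b04's plain-matrix
dictionary `B4GaussRep36`.  THIS FILE runs it over the typer/p35 lineage of CONCRETE (Higgs)₂,₃ operators
(`HiggsLattice` tori `T^{(k)}_{L^kε}`, fields `φ : T^{(k)} → ℝ^N`, `B1Eq230FluctCov.precOpA` = `a(L^{k+1}ε)^{−2}P(A) +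
Δ^{(k),L^kε}(Ω,A)`, `HiggsCondCov232.condCov232` = `C^{(k)}_Λ(Ω,A)` (2.32), `deltaCov235` = `δC^{(k)}_Λ(Ω,A)` (2.35)) — no
twin statement, every object used BY NAME.

WHAT IS PRINTED.  B1 p. 611 [PDF 9] – p. 612 [PDF 10], verbatim: *"Proposition 2.3. If a configuration A is regular on Ω
in the sense defined in Proposition 2.1, then there exist positive constants δ₀, c₀, γ₀, γ₁, dependent on d and a, and
independent of A, k, Ω and Λ, such that γ₀I ≦ aL^{−2}P(A) + Δ^{(k)}(Ω, A) ≦ γ₁I, (2.33) |C^{(k)}_Λ(Ω, A; x, x′)| ≦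
c₀ exp(−δ₀|x − x′|), x, x′ ∈ Λ. (2.34) In particular the above inequality holds for C^{(k)}(Ω, A). Putting
δC^{(k)}_Λ(Ω, A) = C^{(k)}_Λ(Ω, A) − C^{(k)}(Ω, A), (2.35) we have |δC^{(k)}_Λ(Ω, A; x, x′)| ≦ c₀ exp(−δ₀(|x − x′| +
dist(x, Λᶜ) + dist(x′, Λᶜ))), x, x′ ∈ Λ. (2.36) Finally, for Ω ⊂ Ω₀ and δC^{(k)}_Λ(Ω, Ω₀, A) = C^{(k)}_Λ(Ω, A) −
C^{(k)}_Λ(Ω₀, A), (2.37) we have similarly |δC^{(k)}_Λ(Ω, Ω₀, A; x, x′)| ≦ c₀ exp(−δ₀(|x − x′| + dist(x, Ω^{(k)c}) +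
dist(x′, Ω^{(k)c}))), x, x′ ∈ Λ. (2.38) The proof of Propositions 2.1–2.3 will be published separately [13]."*; and
[Balaban1983RegularityDecay] (= [13]) p. 594 [PDF 24]: *"Finally Corollary 2.3 implies that the considered operator is
short-ranged in the sense that for some δ₀ > 0 |(Δ^{(k)}(Ω,A) + aL^{−2}P(A))(x,x′)| ≦ c₀e^{−δ₀|x−x′|}, x, x′ ∈ Ω^{(k)},
(5.4) and a change of the domain Ω implies a change of the operator which can be estimated in the following way
|(Δ^{(k)}(Ω,A) − Δ^{(k)}(Ω₀,A))(x,x′)| ≦ c₀e^{−δ₀(|x−x′| + dist(x,Ω^{(k)c}) + dist(x′,Ω^{(k)c}))}, Ω ⊂ Ω₀, x, x′ ∈ Ω^{(k)}.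
(5.5) From these properties it follows that Proposition I.2.3 is a consequence of the following Theorem. Let Ω ⊂ Z^d
and let A be a symmetric operator … A ≧ γ₀I, |A(x, x′)| ≦ c₀e^{−δ₀|x−x′|}, x, x′ ∈ Ω. (5.6) Then there exist positive
constants c₁, δ₁ such that for arbitrary Λ ⊂ Ω and for C_Λ = A_Λ^{−1}, A_Λ … defined on L²(Λ) by A_Λ = ΛAΛ. We have
|C_Λ(x, x′)| ≦ c₁e^{−δ₁|x−x′|}, x, x′ ∈ Λ, (5.7) |δC_Λ(x, x′)| ≦ c₁e^{−δ₁(|x−x′| + dist(x, Λᶜ) + dist(x′, Λᶜ))}, δC_Λ =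
C_Λ − C_Ω. (5.8) … (5.9) … (5.10)"* — the Theorem ((5.6) ⇒ (5.7), (5.8), (5.10)) is KERNEL-PROVED in the tree over an
arbitrary finite index set with a pseudo-distance of uniform lattice-sum profile (`B4Sect5Torus.sect5_uniform`, pv09;
ℤ^d: `B4Sect5Proof`, pv23), with the explicit constants `cSt K γ₀ c₀ δ₀`, `dSt K γ₀ c₀ δ₀`; its torus geometry
(`B4Sect5Torus.tdist`, `torusSum_le`, `trho_sumBound`) serves every discrete torus `Π_μ ℤ/n_μℤ`.

WHAT THIS FILE PROVES (kernel-checked, zero `sorry`, standard axioms; NO `Prop`-valued definition, no named fact; the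
definitions are the dictionary of (1.3) into the engine's torus and the boundary weight `dist(x, Λᶜ)` of (2.36)):
* §1 GEOMETRY: the sites `HiggsLattice.Site P k` of `T^{(k)}` ARE a discrete torus of the engine (`toT`, injective),
  the engine's distance IS the printed torus distance (1.3) in lattice units (`sdist_eq_tdist`:
  `B4Sect5Torus.tdist ∘ toT = HiggsLattice.Site.tdist` — the circular distance of `ℤ/nℤ` computed from `ZMod.val`),
  hence the index distance `rho` on `T^{(k)} × {components}` is a pseudo-distance with the uniform profile
  `Σ_q e^{−a·rho(p,q)} ≤ N·K_d(a)` for EVERY torus of the model (every `ε, L, M, L′_μ, K, k`) (`rho_isPseudoDist`,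
  `rho_sumBound`); `distC Λ x = dist(x, Λᶜ)`.
* §2 THE §5 THEOREM ON THE CONCRETE CARRIER, for an ARBITRARY operator `M` on the fields of `T^{(k)}` that is
  symmetric for (1.5), bounded below `γ₀‖f‖² ≤ ⟨f, Mf⟩` and short-ranged `|M(p,q)| ≤ c₀e^{−δ₀|x_p−x_q|}` in p35's
  coordinates `B1Eq230FluctCov.mat` ((5.6) ⇒ `hyp56_mat`): **`restrictInv_decay`** (5.7) for the typer's
  `(M↾_Λ)^{−1} = HiggsCondCov232.restrictInv Λ M`, **`restrictInv_sub_inv_decay`** (5.8) for `(M↾_Λ)^{−1} − M^{−1}`,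
  **`restrictInv_sub_restrictInv_decay`** (5.10) for `(M↾_Λ)^{−1} − (M₀↾_Λ)^{−1}` under (5.9) for `M₀ − M` with any
  nonnegative Lipschitz boundary weight — the `Λ`-block of `mat (restrictInv Λ M)` being EXACTLY the engine's
  `(A_Λ)^{−1} = ((mat M).submatrix _ _)^{−1}` (`blkIn_mat_inv_eq`, from the typer's `blkIn_mat_restrictInv_mul`).
* §3 **(2.34)** `ineq234_concrete` and **(2.36)** `ineq236_concrete` for `C^{(k)}_Λ(Ω,A) = condCov232 C Ω A m² a k Λ`
  and `δC^{(k)}_Λ(Ω,A) = deltaCov235 C Ω A m² a k Λ`, for EVERY `k`, finite `Λ ⊂ T^{(k)}`, `Ω ⊂ T_ε`, `A`, `ChargeData`,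
  torus, GIVEN the input (5.6) for the precision operator `precOpA C Ω A m² a k`: the lower half (2.33)ₗ
  `γ₀‖f‖² ≤ ⟨f, (a(L^{k+1}ε)^{−2}P(A) + Δ^{(k)}(Ω,A))f⟩` and the short-range bound (5.4); the constants
  `(c₁, δ₁) = (cSt, dSt)(N·K_d; γ₀, c₀, δ₀)` depend on `(d, N, γ₀, c₀, δ₀)` ONLY — *"independent of A, k, Ω and Λ"*
  and of the volume.  **(2.38)-shape** `ineq238_concrete`: for `Ω ⊂ Ω₀` (any two regions), GIVEN (5.6) for both
  precision operators and (5.5) for `Δ^{(k)}(Ω₀,A) − Δ^{(k)}(Ω,A)` with a boundary weight `w` (the print's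
  `dist(x, Ω^{(k)c})`), the difference (2.37) obeys (2.38) with that weight.  Entries off `Λ` vanish
  (`mat_condCov232_eq_zero_left/right`).
* §4 (v1.1) THE `P(A)`-PART OF (5.4) ([13] p. 594 *"Corollary 2.3 implies that the considered operator is
  short-ranged"*): the coordinate kernel of the one-step `P(A) = Q^*(A)Q(A)` is BLOCK-DIAGONAL with entries `≤ 1`
  (`mat_blockProjA_eq_zero`, `abs_mat_blockProjA_le_one` — polarisation `abs_mat_le_of_form_bounds` of `0 ≤ P(A) ≤ 1`;
  blocks have diameter `≤ L − 1` in (1.3), `tdist_le_of_blockOf_eq`), so `|P(A)(p,q)| ≤ e^{δ(L−1)}e^{−δ|x_p−x_q|}` for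
  every `δ ≥ 0`, every `A`, `k < K` (`abs_mat_blockProjA_le`); hence the input (5.4) for the precision operator follows
  from a decay bound for the kernel of `Δ^{(k)}(Ω,A)` ALONE (`hker_precOpA_of_deltaKA`), for `k ≥ 1` from one for the
  kernel of `Q_k(A)G^ε_k(Ω,A)Q_k^*(A)` via (2.21) (`abs_mat_deltaKA_succ_le`), and (2.34)/(2.36) hold with these inputs
  (`ineq234_concrete_of_deltaKA`, `ineq236_concrete_of_deltaKA`).
* §5 (v1.2) (5.4) FOR `k ≥ 1` FROM THE PAIRING SHAPE OF [13] COROLLARY 2.3 for `G^ε_k(Ω,A)`: by the adjointness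
  of `Q_k(A)`, `Q_k^*(A)` the kernel of `Q_k(A)GQ_k^*(A)` is `(L^kε)^{−d}⟨Q_k^*e_p, GQ_k^*e_q⟩` (`mat_QGQ_eq`) between fields
  localised in the blocks `B^k(x_p)`, `B^k(x_q)` (`avgQkAdj_cb_eq_zero`) of (1.5)-norm² `(L^kε)^d` (`siteInner_avgQkAdj_cb`),
  so a pairing bound `|⟨g, Gg′⟩| ≤ c₀e^{−δ₀|y−y′|}‖g‖‖g′‖` for block-localised `g, g′` gives `|(Q_kGQ_k^*)(p,q)| ≤
  c₀e^{−δ₀|x_p−x_q|}` (`abs_mat_QGQ_le`); two blocks `B^k(y)`, `B^k(y′)` are `≥ L^k|y−y′| − (L^k−1)` apart in `T_ε`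
  (`mul_tdist_blockIter_le`, `k ≤ K`), so the printed shape with `dist(supp g, supp g′)` in units of `T^{(k)}` implies
  the block form with `c₀ ↦ c₀e^{δ₀}` (`pairing_block_of_sep`); whence (5.4) at level `k ≥ 1` (`hker_precOpA_succ_of_sep`)
  and **(2.34)/(2.36) for the concrete `C^{(k)}_Λ(Ω,A)`, `δC^{(k)}_Λ(Ω,A)`, `1 ≤ k < K`, from (2.33)ₗ + the Corollary-2.3
  shape for `G^ε_k(Ω,A) = HiggsCovariance.propagatorK`** (`ineq234_concrete_of_sep`, `ineq236_concrete_of_sep`).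
HONEST SCOPE.  (i) This is the printed DERIVATION (5.6) ⇒ (2.34)–(2.38) on the concrete carrier, not a discharge of its
inputs: the lower bound (2.33)ₗ with a UNIFORM `γ₀` and the short-range bounds (5.4)/(5.5) for general regular `A` are
B4's Proposition II.3.1′ / Corollary 2.3 ([Balaban1983RegularityDecay] (5.1)–(5.5)); on the concrete carrier the tree has
so far the qualitative positivity `B1Eq230FluctCovPos.siteInner_precOpA_pos` and the upper half `B1Ineq233Upper`.
(ii) Kernels are the colour-resolved coordinate entries `mat X ((x,i),(x′,i′))` of p35's dictionary (orthonormal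
components of `ℝ^N`), i.e. the kernel w.r.t. the UNWEIGHTED sum; on the unit lattice `T₁^{(k)}` (the print's (2.31)/(2.34),
`P.unitAt k`, weight `1`) these are the printed kernels, on `T^{(k)}_{L^kε}` they differ from the (1.5)-kernels by the
constant `(L^kε)^{−d}`.  (iii) `|x − x′|` = (1.3) in lattice units of `T^{(k)}` (`HiggsLattice.Site.tdist`), `dist(x, Λᶜ)`
= `distC` (`0` if `Λ = T^{(k)}`), `Λ` an ARBITRARY finite set of sites (the print: unions of big blocks).  (iv) Value =
kernel certificate of a by-reference derivation for the concrete objects B2 (2.45)/(2.46), B3 (1.16) condition on; NOT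
summit progress.  Unit `lit-balaban-r14-g7` (literature-prover-lit-balaban-r14-g7-0); HOME/FILED.md records the proposal.
-/

namespace Literature.MathematicalPhysics.QuantumFieldTheory.Balaban1983to89.B1Ineq234Concrete

open HiggsLattice HiggsCovariance B1Eq221Coordinates B1Eq230FluctCov B1Eq230FluctCovPos HiggsCondCov232
  HiggsCondGauss228 B2Eq255Concrete
open HiggsFluctMeasurePos (siteInner_self_pos siteInner_comm)
open HiggsCovariancePos (siteInner_avgQkLin)
open B2Eq228Conditioning (In blkIn)
open B4Sect5Torus (IsPseudoDist SumBound Hyp56 Hyp59 cSt dSt sect5_uniform TSite TIdx trho trho_isPseudoDist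
  trho_sumBound profile_nonneg)
open B4TorusKernel.MultiPeriod (circAbs)
open scoped BigOperators InnerProductSpace Matrix
open Matrix

noncomputable section

variable {P : HiggsLattice.Params} {N : ℕ} {k : ℕ}

/-! ## §1 The torus `T^{(k)}` of (1.2)/(1.3) IS a discrete torus of the §5 engine; `dist(x, Λᶜ)` -/

/-- The number `N` of components of `ℝ^N` as p34's coordinate count `finrank ℝ ℝ^N` (the internal index `Ix N` of
`B1Eq230FluctCov.mat` is `Fin (nCol N)`). [cite: Balaban1982Higgs1, (1.5) p.604] -/
abbrev nCol (N : ℕ) : ℕ := Module.finrank ℝ (E N)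

/-- `nCol N = N`. [cite: Balaban1982Higgs1, (1.5) p.604] -/
theorem nCol_eq (N : ℕ) : nCol N = N := finrank_euclideanSpace_fin

/-- The period vector `(2L^{K−k}ML′_μ)_μ` of `T^{(k)}` ((1.2)/(1.20)). [cite: Balaban1982Higgs1, (1.2) p.604] -/
def periods (P : HiggsLattice.Params) (k : ℕ) : Fin P.d → ℕ := fun μ => P.sitesPerDir k μ

/-- The periods are `≥ 1`. [cite: Balaban1982Higgs1, (1.2) p.604] -/
theorem one_le_periods (P : HiggsLattice.Params) (k : ℕ) (μ : Fin P.d) : 1 ≤ periods P k μ :=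
  P.sitesPerDir_pos k μ

/-- A site of `T^{(k)}` as a point of the engine's torus `Π_μ Fin(2L^{K−k}ML′_μ)` (coordinatewise `ZMod.val`).
[cite: Balaban1982Higgs1, (1.2) p.604] -/
def toT (x : HiggsLattice.Site P k) : TSite P.d (periods P k) :=
  fun μ => ⟨(x μ).val, ZMod.val_lt (x μ)⟩

/-- `toT` is injective. [cite: Balaban1982Higgs1, (1.2) p.604] -/
theorem toT_injective : Function.Injective (toT (P := P) (k := k)) := by
  intro x y h
  funext μ
  have := congrFun h μ
  simp only [toT, Fin.mk.injEq] at this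
  exact ZMod.val_injective _ this

/-- The engine's torus distance of two sites of `T^{(k)}` (real-valued). [cite: Balaban1982Higgs1, (1.3) p.604] -/
def sdist (x y : HiggsLattice.Site P k) : ℝ := B4Sect5Torus.tdist (periods P k) (toT x) (toT y)

/-- The circular distance of `ℤ/nℤ` from `ZMod.val`: `dist(a − b, nℤ) = min{(a − b) mod n, (b − a) mod n}`.
[cite: Balaban1982Higgs1, (1.3) p.604] -/
theorem circAbs_val_sub {n : ℕ} [NeZero n] (a b : ZMod n) :
    (circAbs n (((a.val : ℕ) : ℤ) - ((b.val : ℕ) : ℤ))).toNat = min (a - b).val (b - a).val := by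
  have hab : (a - b : ZMod n) = (((a.val : ℤ) - (b.val : ℤ) : ℤ) : ZMod n) := by
    push_cast
    rw [ZMod.natCast_zmod_val, ZMod.natCast_zmod_val]
  have hr : (((a - b).val : ℕ) : ℤ) = ((a.val : ℤ) - (b.val : ℤ)) % (n : ℤ) := by
    rw [hab, ZMod.val_intCast]
  have hs : (b - a).val = if a - b = 0 then 0 else n - (a - b).val := by
    rw [← neg_sub, ZMod.neg_val]
  unfold circAbs
  rw [← hr, hs]
  split_ifs with h0
  · rw [h0, ZMod.val_zero]; simp
  · have hlt : (a - b).val < n := ZMod.val_lt _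
    have : ((n : ℤ) - (((a - b).val : ℕ) : ℤ)) = ((n - (a - b).val : ℕ) : ℤ) := by
      rw [Nat.cast_sub hlt.le]
    rw [this, ← Nat.cast_min, Int.toNat_natCast]

/-- **The engine's torus distance IS the printed distance (1.3)** p. 604, *"|x − y| = max_μ min{|x_μ − y_μ|,
2L_μ − |x_μ − y_μ|}"*, in lattice units of `T^{(k)}` (`HiggsLattice.Site.tdist`). [cite: Balaban1982Higgs1, (1.3) p.604] -/
theorem sdist_eq_tdist (x y : HiggsLattice.Site P k) : sdist x y = (HiggsLattice.Site.tdist x y : ℝ) := by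
  unfold sdist B4Sect5Torus.tdist HiggsLattice.Site.tdist
  congr 2
  funext μ
  simp only [B4Sect5Torus.ccoord, toT]
  exact circAbs_val_sub (x μ) (y μ)

/-- A coordinate index `(x, i)` of a field on `T^{(k)}` as an index of the engine's torus (component count `nCol N`).
[cite: Balaban1982Higgs1, (1.5) p.604] -/
def emb (p : HiggsLattice.Site P k × Ix N) : TIdx (periods P k) Finset.univ (nCol N) :=
  (⟨toT p.1, Finset.mem_univ _⟩, p.2)

/-- `emb` is injective. [cite: Balaban1982Higgs1, (1.5) p.604] -/
theorem emb_injective : Function.Injective (emb (P := P) (N := N) (k := k)) := by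
  rintro ⟨x, i⟩ ⟨y, j⟩ h
  simp only [emb, Prod.mk.injEq, Subtype.mk.injEq] at h
  exact Prod.ext (toT_injective h.1) h.2

/-- The index distance `|x_p − x_q|` of two coordinate indices (the distance (1.3) of their sites), as the pull-back
of the engine's `trho`. [cite: Balaban1982Higgs1, (1.3) p.604] -/
def rho (p q : HiggsLattice.Site P k × Ix N) : ℝ := trho (periods P k) Finset.univ (nCol N) (emb p) (emb q)

/-- `rho p q = |x_p − x_q|` (1.3). [cite: Balaban1982Higgs1, (1.3) p.604] -/
theorem rho_eq_tdist (p q : HiggsLattice.Site P k × Ix N) : rho p q = (HiggsLattice.Site.tdist p.1 q.1 : ℝ) :=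
  sdist_eq_tdist p.1 q.1

/-- `rho` is a pseudo-distance (engine: `trho_isPseudoDist`). [cite: Balaban1982Higgs1, (1.3) p.604] -/
theorem rho_isPseudoDist : IsPseudoDist (rho (P := P) (N := N) (k := k)) :=
  (trho_isPseudoDist (one_le_periods P k) Finset.univ (nCol N)).comp emb

/-- The lattice-sum profile `K(a) = N·K_d(a)` of every torus of the model (`B4Sect5Proof.latticeConst`, the ℤ^d constant).
[cite: Balaban1983RegularityDecay, Sect. 5 Theorem p.594] -/
abbrev profile (P : HiggsLattice.Params) (N : ℕ) : ℝ → ℝ := fun a => (nCol N : ℝ) * B4Sect5Proof.latticeConst P.d a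

/-- **Uniform lattice sums on every torus of the model**: `Σ_q e^{−a·rho(p,q)} ≤ N·K_d(a)`, independent of
`ε, L, M, L′_μ, K, k` (engine: `trho_sumBound` ⇐ `torusSum_le`). [cite: Balaban1983RegularityDecay, Sect. 5 Theorem p.594] -/
theorem rho_sumBound : SumBound (rho (P := P) (N := N) (k := k)) (profile P N) :=
  (trho_sumBound (one_le_periods P k) Finset.univ (nCol N)).comp emb_injective

/-- The profile is nonnegative. [cite: Balaban1983RegularityDecay, Sect. 5 Theorem p.594] -/
theorem profile_nonneg' : ∀ a : ℝ, 0 < a → 0 ≤ profile P N a := profile_nonneg P.d (nCol N)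

/-- **`dist(x, Λᶜ)`** of (2.36): `min{|x − y| : y ∉ Λ}` in the distance (1.3) of `T^{(k)}`; `0` when `Λ = T^{(k)}` (then
`δC^{(k)}_Λ = 0`, `HiggsCondCov232.deltaCov235_univ`). [cite: Balaban1982Higgs1, (2.36) p.612] -/
def distC (Λ : Finset (HiggsLattice.Site P k)) (x : HiggsLattice.Site P k) : ℝ :=
  if h : (Λᶜ).Nonempty then (Λᶜ).inf' h (fun y => (HiggsLattice.Site.tdist x y : ℝ)) else 0

/-- `dist(x, Λᶜ) ≥ 0`. [cite: Balaban1982Higgs1, (2.36) p.612] -/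
theorem distC_nonneg (Λ : Finset (HiggsLattice.Site P k)) (x : HiggsLattice.Site P k) : 0 ≤ distC Λ x := by
  unfold distC
  split_ifs with h
  · exact (Finset.le_inf'_iff h _).mpr fun y _ => Nat.cast_nonneg _
  · exact le_rfl

/-- `dist(x, Λᶜ) ≤ |x − y|` for `y ∉ Λ`. [cite: Balaban1982Higgs1, (2.36) p.612] -/
theorem distC_le (Λ : Finset (HiggsLattice.Site P k)) (x : HiggsLattice.Site P k) {y : HiggsLattice.Site P k}
    (hy : y ∉ Λ) : distC Λ x ≤ (HiggsLattice.Site.tdist x y : ℝ) := by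
  have hy' : y ∈ Λᶜ := Finset.mem_compl.mpr hy
  unfold distC
  rw [dif_pos ⟨y, hy'⟩]
  exact Finset.inf'_le _ hy'

/-- `dist(x, T^{(k)ᶜ}) = 0`. [cite: Balaban1982Higgs1, (2.36) p.612] -/
theorem distC_univ (x : HiggsLattice.Site P k) : distC Finset.univ x = 0 := by
  unfold distC
  rw [dif_neg]
  simp

/-! ## §2 The §5 Theorem of [13] for an arbitrary operator on the fields of `T^{(k)}`, in p35's coordinates -/

section Generic

variable (M : Module.End ℝ (ScalarField P k N))

/-- The coordinate matrix as a bilinear form: `u·(mat M)v = (L^kε)^{−d}⟨φ_u, Mφ_v⟩_{(1.5)}`. [cite: Balaban1982Higgs1, (1.5) p.604] -/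
theorem dotProduct_mat_mulVec (u v : HiggsLattice.Site P k × Ix N → ℝ) :
    u ⬝ᵥ (mat M *ᵥ v) = (P.mesh k ^ P.d)⁻¹ *
      siteInner ((fieldCoord (E N) (HiggsLattice.Site P k)).symm u)
        (M ((fieldCoord (E N) (HiggsLattice.Site P k)).symm v)) := by
  have hw : (P.mesh k ^ P.d) ≠ 0 := (pow_pos (P.mesh_pos k) _).ne'
  rw [mat_mulVec_crd, siteInner_eq_dotProduct, LinearEquiv.apply_symm_apply, ← mul_assoc, inv_mul_cancel₀ hw,
    one_mul]

/-- `u·u = (L^kε)^{−d}‖φ_u‖²_{(1.5)}`. [cite: Balaban1982Higgs1, (1.5) p.604] -/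
theorem dotProduct_self_eq_siteInner (u : HiggsLattice.Site P k × Ix N → ℝ) :
    u ⬝ᵥ u = (P.mesh k ^ P.d)⁻¹ *
      siteInner ((fieldCoord (E N) (HiggsLattice.Site P k)).symm u)
        ((fieldCoord (E N) (HiggsLattice.Site P k)).symm u) := by
  have hw : (P.mesh k ^ P.d) ≠ 0 := (pow_pos (P.mesh_pos k) _).ne'
  rw [siteInner_eq_dotProduct, LinearEquiv.apply_symm_apply, ← mul_assoc, inv_mul_cancel₀ hw, one_mul]

variable {M}

/-- An operator symmetric for (1.5) has a symmetric coordinate matrix (*"let A be a symmetric operator"*, (5.6)).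
[cite: Balaban1983RegularityDecay, (5.6) p.594] -/
theorem mat_isSymm (hsymm : ∀ f g : ScalarField P k N, siteInner f (M g) = siteInner g (M f)) :
    (mat M).IsSymm := by
  unfold Matrix.IsSymm
  refine Matrix.ext_iff_mulVec.mpr fun v => funext fun i => ?_
  rw [Matrix.mulVec_transpose, ← single_one_dotProduct i (v ᵥ* mat M), dotProduct_comm,
    ← Matrix.dotProduct_mulVec, dotProduct_mat_mulVec, hsymm, ← dotProduct_mat_mulVec, single_one_dotProduct]

/-- **(5.6) on the concrete carrier ⇒ the engine's `Hyp56`**: symmetry for (1.5), the form lower bound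
`γ₀‖f‖² ≤ ⟨f, Mf⟩` and the short-range bound `|M(p, q)| ≤ c₀e^{−δ₀|x_p − x_q|}` of the coordinate kernel give
`B4Sect5Torus.Hyp56 rho (mat M) γ₀ c₀ δ₀`. [cite: Balaban1983RegularityDecay, (5.6) p.594] -/
theorem hyp56_mat {γ₀ c₀ δ₀ : ℝ}
    (hsymm : ∀ f g : ScalarField P k N, siteInner f (M g) = siteInner g (M f))
    (hlow : ∀ f : ScalarField P k N, γ₀ * siteInner f f ≤ siteInner f (M f))
    (hker : ∀ p q : HiggsLattice.Site P k × Ix N,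
      |mat M p q| ≤ c₀ * Real.exp (-(δ₀ * (HiggsLattice.Site.tdist p.1 q.1 : ℝ)))) :
    Hyp56 rho (mat M) γ₀ c₀ δ₀ := by
  refine ⟨mat_isSymm hsymm, fun v => ?_, fun p q => by rw [rho_eq_tdist]; exact hker p q⟩
  have h1 : ∑ p, v p ^ 2 = v ⬝ᵥ v := by simp [dotProduct, sq]
  have h2 : ∑ p, v p * (mat M *ᵥ v) p = v ⬝ᵥ (mat M *ᵥ v) := rfl
  rw [h1, h2, dotProduct_mat_mulVec, dotProduct_self_eq_siteInner, mul_left_comm]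
  exact mul_le_mul_of_nonneg_left (hlow _) (inv_nonneg.mpr (pow_pos (P.mesh_pos k) _).le)

/-- A uniform lower bound `γ₀ > 0` makes `M` positive definite (so `M↾_Λ` is invertible on the `Λ`-configurations,
`HiggsCondCov232.isUnit_padOp`). [cite: Balaban1982Higgs1, (2.33) p.611] -/
theorem pos_of_low {γ₀ : ℝ} (hγ : 0 < γ₀)
    (hlow : ∀ f : ScalarField P k N, γ₀ * siteInner f f ≤ siteInner f (M f)) :
    ∀ φ : ScalarField P k N, φ ≠ 0 → 0 < siteInner φ (M φ) := fun φ hφ =>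
  lt_of_lt_of_le (mul_pos hγ (siteInner_self_pos hφ)) (hlow φ)

/-- **The `Λ`-block of `mat (M↾_Λ)^{−1}` IS the engine's `C_Λ = A_Λ^{−1}`**: `((mat M)_Λ)^{−1} = (mat (restrictInv Λ M))_Λ`
(the typer's `blkIn_mat_restrictInv_mul` + `blkIn_mat_restrictOp`). [cite: Balaban1982Higgs1, (2.32) p.611] -/
theorem blkIn_mat_inv_eq (Λ : Finset (HiggsLattice.Site P k)) (hU : IsUnit (padOp Λ M)) :
    (blkIn (inSet N Λ) (mat M))⁻¹ = blkIn (inSet N Λ) (mat (restrictInv Λ M)) := by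
  refine Matrix.inv_eq_left_inv ?_
  rw [← blkIn_mat_restrictOp Λ M]
  exact blkIn_mat_restrictInv_mul Λ M hU

/-- p15's block `blkIn` is the engine's compression `A.submatrix val val` along `Λ ↪ T^{(k)}` (definitional).
[cite: Balaban1983RegularityDecay, Sect. 5 Theorem p.594] -/
theorem submatrix_eq_blkIn (Λ : Finset (HiggsLattice.Site P k))
    (X : Matrix (HiggsLattice.Site P k × Ix N) (HiggsLattice.Site P k × Ix N) ℝ) :
    X.submatrix (Subtype.val : In (inSet (P := P) N Λ) → _) Subtype.val = blkIn (inSet N Λ) X := rfl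

/-- **(5.7) on the concrete carrier**: for `M` symmetric for (1.5) with `γ₀‖f‖² ≤ ⟨f, Mf⟩` and
`|M(p,q)| ≤ c₀e^{−δ₀|x_p−x_q|}`, and for EVERY finite `Λ ⊂ T^{(k)}`: `|(M↾_Λ)^{−1}(p, q)| ≤ c₁e^{−δ₁|x_p − x_q|}`,
`p, q ∈ Λ × {components}`, with `(c₁, δ₁) = (cSt, dSt)(N·K_d; γ₀, c₀, δ₀)` independent of `Λ`, `k` and the torus.
[cite: Balaban1983RegularityDecay, (5.7) p.594] -/
theorem restrictInv_decay {γ₀ c₀ δ₀ : ℝ} (hγ : 0 < γ₀) (hc : 0 < c₀) (hδ : 0 < δ₀)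
    (hsymm : ∀ f g : ScalarField P k N, siteInner f (M g) = siteInner g (M f))
    (hlow : ∀ f : ScalarField P k N, γ₀ * siteInner f f ≤ siteInner f (M f))
    (hker : ∀ p q : HiggsLattice.Site P k × Ix N,
      |mat M p q| ≤ c₀ * Real.exp (-(δ₀ * (HiggsLattice.Site.tdist p.1 q.1 : ℝ))))
    (Λ : Finset (HiggsLattice.Site P k)) {p q : HiggsLattice.Site P k × Ix N} (hp : p.1 ∈ Λ) (hq : q.1 ∈ Λ) :
    |mat (restrictInv Λ M) p q| ≤
      cSt (profile P N) γ₀ c₀ δ₀ *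
        Real.exp (-(dSt (profile P N) γ₀ c₀ δ₀ * (HiggsLattice.Site.tdist p.1 q.1 : ℝ))) := by
  have hU : IsUnit (padOp Λ M) := isUnit_padOp Λ (pos_of_low hγ hlow)
  have main := (sect5_uniform (profile_nonneg' (P := P) (N := N)) hγ hc hδ rho_isPseudoDist rho_sumBound
    (hyp56_mat hsymm hlow hker) (Subtype.val_injective (p := inSet (P := P) N Λ))).1 ⟨p, hp⟩ ⟨q, hq⟩
  rw [submatrix_eq_blkIn, blkIn_mat_inv_eq Λ hU] at main
  rw [← rho_eq_tdist]
  exact main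

/-- **(5.8) on the concrete carrier**: under the same hypotheses, `|((M↾_Λ)^{−1} − M^{−1})(p, q)| ≤
c₁e^{−δ₁(|x_p − x_q| + dist(x_p, Λᶜ) + dist(x_q, Λᶜ))}`, `p, q ∈ Λ × {components}` (`M^{−1}` = `Ring.inverse M`, the
typer/p35 convention). [cite: Balaban1983RegularityDecay, (5.8) p.594] -/
theorem restrictInv_sub_inv_decay {γ₀ c₀ δ₀ : ℝ} (hγ : 0 < γ₀) (hc : 0 < c₀) (hδ : 0 < δ₀)
    (hsymm : ∀ f g : ScalarField P k N, siteInner f (M g) = siteInner g (M f))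
    (hlow : ∀ f : ScalarField P k N, γ₀ * siteInner f f ≤ siteInner f (M f))
    (hker : ∀ p q : HiggsLattice.Site P k × Ix N,
      |mat M p q| ≤ c₀ * Real.exp (-(δ₀ * (HiggsLattice.Site.tdist p.1 q.1 : ℝ))))
    (Λ : Finset (HiggsLattice.Site P k)) {p q : HiggsLattice.Site P k × Ix N} (hp : p.1 ∈ Λ) (hq : q.1 ∈ Λ) :
    |mat (restrictInv Λ M) p q - mat (Ring.inverse M) p q| ≤
      cSt (profile P N) γ₀ c₀ δ₀ *
        Real.exp (-(dSt (profile P N) γ₀ c₀ δ₀ *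
          ((HiggsLattice.Site.tdist p.1 q.1 : ℝ) + distC Λ p.1 + distC Λ q.1))) := by
  have hU : IsUnit (padOp Λ M) := isUnit_padOp Λ (pos_of_low hγ hlow)
  have main := (sect5_uniform (profile_nonneg' (P := P) (N := N)) hγ hc hδ rho_isPseudoDist rho_sumBound
    (hyp56_mat hsymm hlow hker) (Subtype.val_injective (p := inSet (P := P) N Λ))).2.1
    (fun i => distC Λ i.val.1) (fun i => distC_nonneg Λ _) ?_ ⟨p, hp⟩ ⟨q, hq⟩
  · rw [submatrix_eq_blkIn, blkIn_mat_inv_eq Λ hU, ← mat_inverse] at main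
    rw [← rho_eq_tdist]
    exact main
  · intro i z hz
    have hz' : z.1 ∉ Λ := fun hzΛ => hz ⟨⟨z, hzΛ⟩, rfl⟩
    rw [rho_eq_tdist]
    exact distC_le Λ _ hz'

/-- **(5.10) on the concrete carrier**: two operators `M` (for `Ω`) and `M₀` (for `Ω₀`), both with (5.6), whose
difference obeys (5.9) `|(M₀ − M)(p,q)| ≤ c₀e^{−δ₀(|x_p−x_q| + w(x_p) + w(x_q))}` for a nonnegative boundary weight `w`
with `w(x) ≤ |x − y| + w(y)` (the print's `dist(x, Ω^{(k)c})`): `|((M↾_Λ)^{−1} − (M₀↾_Λ)^{−1})(p,q)| ≤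
c₁e^{−δ₁(|x_p−x_q| + w(x_p) + w(x_q))}`, `p, q ∈ Λ × {components}`. [cite: Balaban1983RegularityDecay, (5.10) p.594] -/
theorem restrictInv_sub_restrictInv_decay {M₀ : Module.End ℝ (ScalarField P k N)} {γ₀ c₀ δ₀ : ℝ}
    (hγ : 0 < γ₀) (hc : 0 < c₀) (hδ : 0 < δ₀)
    (hsymm : ∀ f g : ScalarField P k N, siteInner f (M g) = siteInner g (M f))
    (hlow : ∀ f : ScalarField P k N, γ₀ * siteInner f f ≤ siteInner f (M f))
    (hker : ∀ p q : HiggsLattice.Site P k × Ix N,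
      |mat M p q| ≤ c₀ * Real.exp (-(δ₀ * (HiggsLattice.Site.tdist p.1 q.1 : ℝ))))
    (hsymm₀ : ∀ f g : ScalarField P k N, siteInner f (M₀ g) = siteInner g (M₀ f))
    (hlow₀ : ∀ f : ScalarField P k N, γ₀ * siteInner f f ≤ siteInner f (M₀ f))
    (hker₀ : ∀ p q : HiggsLattice.Site P k × Ix N,
      |mat M₀ p q| ≤ c₀ * Real.exp (-(δ₀ * (HiggsLattice.Site.tdist p.1 q.1 : ℝ))))
    {w : HiggsLattice.Site P k → ℝ} (hw0 : ∀ x, 0 ≤ w x)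
    (hwLip : ∀ x y, w x ≤ (HiggsLattice.Site.tdist x y : ℝ) + w y)
    (hdiff : ∀ p q : HiggsLattice.Site P k × Ix N,
      |mat M₀ p q - mat M p q| ≤
        c₀ * Real.exp (-(δ₀ * ((HiggsLattice.Site.tdist p.1 q.1 : ℝ) + w p.1 + w q.1))))
    (Λ : Finset (HiggsLattice.Site P k)) {p q : HiggsLattice.Site P k × Ix N} (hp : p.1 ∈ Λ) (hq : q.1 ∈ Λ) :
    |mat (restrictInv Λ M) p q - mat (restrictInv Λ M₀) p q| ≤
      cSt (profile P N) γ₀ c₀ δ₀ *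
        Real.exp (-(dSt (profile P N) γ₀ c₀ δ₀ *
          ((HiggsLattice.Site.tdist p.1 q.1 : ℝ) + w p.1 + w q.1))) := by
  have hU : IsUnit (padOp Λ M) := isUnit_padOp Λ (pos_of_low hγ hlow)
  have hU₀ : IsUnit (padOp Λ M₀) := isUnit_padOp Λ (pos_of_low hγ hlow₀)
  have hAB : mat M + (mat M₀ - mat M) = mat M₀ := add_sub_cancel _ _
  have h56 : Hyp56 rho (mat M + (mat M₀ - mat M)) γ₀ c₀ δ₀ := by
    rw [hAB]; exact hyp56_mat hsymm₀ hlow₀ hker₀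
  have h59 : Hyp59 rho (fun s => w s.1) (mat M₀ - mat M) c₀ δ₀ := by
    intro s t
    rw [rho_eq_tdist]
    exact hdiff s t
  have main := (sect5_uniform (profile_nonneg' (P := P) (N := N)) hγ hc hδ rho_isPseudoDist rho_sumBound
    (hyp56_mat hsymm hlow hker) (Subtype.val_injective (p := inSet (P := P) N Λ))).2.2
    (mat M₀ - mat M) (fun s => w s.1) h56 (fun s => hw0 s.1) (fun s t => by rw [rho_eq_tdist]; exact hwLip s.1 t.1)
    h59 ⟨p, hp⟩ ⟨q, hq⟩
  rw [hAB, submatrix_eq_blkIn, submatrix_eq_blkIn, blkIn_mat_inv_eq Λ hU, blkIn_mat_inv_eq Λ hU₀] at main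
  rw [← rho_eq_tdist]
  exact main

/-- Coordinate entries of `(M↾_Λ)^{−1}` with the ROW site outside `Λ` vanish (`(M↾_Λ)^{−1}ψ` is a configuration on `Λ`).
[cite: Balaban1982Higgs1, (2.32) p.611] -/
theorem mat_restrictInv_eq_zero_left (Λ : Finset (HiggsLattice.Site P k)) {p : HiggsLattice.Site P k × Ix N}
    (hp : p.1 ∉ Λ) (q : HiggsLattice.Site P k × Ix N) : mat (restrictInv Λ M) p q = 0 := by
  rw [mat, LinearMap.toMatrix_apply, cb_repr, fieldCoord_apply, restrictInv_apply_of_not_mem Λ M _ hp]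
  simp

/-- Coordinate entries of `(M↾_Λ)^{−1}` with the COLUMN site outside `Λ` vanish (`(M↾_Λ)^{−1}` reads only `Λψ`).
[cite: Balaban1982Higgs1, (2.32) p.611] -/
theorem mat_restrictInv_eq_zero_right (Λ : Finset (HiggsLattice.Site P k)) (p : HiggsLattice.Site P k × Ix N)
    {q : HiggsLattice.Site P k × Ix N} (hq : q.1 ∉ Λ) : mat (restrictInv Λ M) p q = 0 := by
  rw [mat, LinearMap.toMatrix_apply, cb_repr, ← restrictInv_cutTo]
  have h0 : cutTo Λ ((cb P N k) q) = 0 := by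
    funext x
    by_cases hx : x ∈ Λ
    · rw [cutTo_of_mem Λ _ hx]
      simp only [cb, Module.Basis.coe_ofEquivFun]
      set φ := (fieldCoord (E N) (HiggsLattice.Site P k)).symm (Pi.single q (1 : ℝ)) with hφ
      have hz : ∀ i, fieldCoord (E N) (HiggsLattice.Site P k) φ (x, i) = 0 := by
        intro i
        rw [hφ, LinearEquiv.apply_symm_apply]
        have hne : (x, i) ≠ q := by
          rintro rfl
          exact hq hx
        exact Pi.single_eq_of_ne hne _
      have h1 : siteCoord (E N) (φ x) = 0 := funext fun i => hz i
      exact (siteCoord (E N)).map_eq_zero_iff.mp h1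
    · exact cutTo_of_not_mem Λ _ hx
  rw [h0, map_zero, map_zero]
  rfl

end Generic

/-! ## §3 Proposition 2.3 (2.34), (2.36) and the shape of (2.38) for the CONCRETE `C^{(k)}_Λ(Ω,A)`, `δC^{(k)}_Λ(Ω,A)` -/

section Concrete

variable (C : ChargeData N) (Ω : Finset (HiggsLattice.Site P 0)) (A : HiggsLattice.VecField P 0) (msq a : ℝ)

/-- **(2.34) FOR THE CONCRETE MODEL, BY THE PRINTED ROUTE OF [13] p. 594** — *"|C^{(k)}_Λ(Ω, A; x, x′)| ≦ c₀ exp(−δ₀|x −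
x′|), x, x′ ∈ Λ. (2.34)"*: for every level `k`, every finite `Λ ⊂ T^{(k)}`, every `Ω`, `A`, `ChargeData`, torus, IF the
precision operator `a(L^{k+1}ε)^{−2}P(A) + Δ^{(k)}(Ω,A)` (`B1Eq230FluctCov.precOpA`) obeys (5.6) — the lower half (2.33)ₗ
`γ₀‖f‖² ≤ ⟨f, (a(L^{k+1}ε)^{−2}P(A) + Δ^{(k)}(Ω,A))f⟩` and the short-range bound (5.4)
`|(a(L^{k+1}ε)^{−2}P(A) + Δ^{(k)}(Ω,A))(p,q)| ≤ c₀e^{−δ₀|x_p−x_q|}` — THEN the coordinate kernel of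
`C^{(k)}_Λ(Ω,A) = HiggsCondCov232.condCov232 C Ω A m² a k Λ` obeys (2.34) with `(c₁, δ₁) = (cSt, dSt)(N·K_d; γ₀, c₀, δ₀)`,
*"independent of A, k, Ω and Λ"* (and of the torus). [cite: Balaban1982Higgs1, Prop. 2.3 (2.34) p.611] -/
theorem ineq234_concrete {γ₀ c₀ δ₀ : ℝ} (hγ : 0 < γ₀) (hc : 0 < c₀) (hδ : 0 < δ₀)
    (hlow : ∀ f : ScalarField P k N, γ₀ * siteInner f f ≤ siteInner f (precOpA C Ω A msq a k f))
    (hker : ∀ p q : HiggsLattice.Site P k × Ix N,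
      |mat (precOpA C Ω A msq a k) p q| ≤ c₀ * Real.exp (-(δ₀ * (HiggsLattice.Site.tdist p.1 q.1 : ℝ))))
    (Λ : Finset (HiggsLattice.Site P k)) {p q : HiggsLattice.Site P k × Ix N} (hp : p.1 ∈ Λ) (hq : q.1 ∈ Λ) :
    |mat (condCov232 C Ω A msq a k Λ) p q| ≤
      cSt (profile P N) γ₀ c₀ δ₀ *
        Real.exp (-(dSt (profile P N) γ₀ c₀ δ₀ * (HiggsLattice.Site.tdist p.1 q.1 : ℝ))) :=
  restrictInv_decay hγ hc hδ (siteInner_precOpA_comm C Ω A msq a k) hlow hker Λ hp hq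

/-- (2.34), the entries off `Λ`: the coordinate kernel of `C^{(k)}_Λ(Ω,A)` vanishes unless both sites lie in `Λ`, so the
bound (2.34) holds for ALL index pairs. [cite: Balaban1982Higgs1, Prop. 2.3 (2.34) p.611] -/
theorem ineq234_concrete_all {γ₀ c₀ δ₀ : ℝ} (hγ : 0 < γ₀) (hc : 0 < c₀) (hδ : 0 < δ₀)
    (hlow : ∀ f : ScalarField P k N, γ₀ * siteInner f f ≤ siteInner f (precOpA C Ω A msq a k f))
    (hker : ∀ p q : HiggsLattice.Site P k × Ix N,
      |mat (precOpA C Ω A msq a k) p q| ≤ c₀ * Real.exp (-(δ₀ * (HiggsLattice.Site.tdist p.1 q.1 : ℝ))))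
    (Λ : Finset (HiggsLattice.Site P k)) (p q : HiggsLattice.Site P k × Ix N) :
    |mat (condCov232 C Ω A msq a k Λ) p q| ≤
      cSt (profile P N) γ₀ c₀ δ₀ *
        Real.exp (-(dSt (profile P N) γ₀ c₀ δ₀ * (HiggsLattice.Site.tdist p.1 q.1 : ℝ))) := by
  by_cases hp : p.1 ∈ Λ
  · by_cases hq : q.1 ∈ Λ
    · exact ineq234_concrete C Ω A msq a hγ hc hδ hlow hker Λ hp hq
    · rw [condCov232, mat_restrictInv_eq_zero_right Λ p hq, abs_zero]
      exact mul_nonneg (B4Sect5Torus.cSt_pos _ c₀ δ₀ hγ).le (Real.exp_pos _).le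
  · rw [condCov232, mat_restrictInv_eq_zero_left Λ hp q, abs_zero]
    exact mul_nonneg (B4Sect5Torus.cSt_pos _ c₀ δ₀ hγ).le (Real.exp_pos _).le

/-- **(2.36) FOR THE CONCRETE MODEL, BY THE PRINTED ROUTE OF [13] p. 594** — *"|δC^{(k)}_Λ(Ω, A; x, x′)| ≦ c₀ exp(−δ₀(|x −
x′| + dist(x, Λᶜ) + dist(x′, Λᶜ))), x, x′ ∈ Λ. (2.36)"* for `δC^{(k)}_Λ(Ω,A) = HiggsCondCov232.deltaCov235 C Ω A m² a k Λ`
(= `C^{(k)}_Λ(Ω,A) − C^{(k)}(Ω,A)`, (2.35)), under the input (5.6) for the precision operator as in `ineq234_concrete`;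
same constants. [cite: Balaban1982Higgs1, Prop. 2.3 (2.36) p.612] -/
theorem ineq236_concrete {γ₀ c₀ δ₀ : ℝ} (hγ : 0 < γ₀) (hc : 0 < c₀) (hδ : 0 < δ₀)
    (hlow : ∀ f : ScalarField P k N, γ₀ * siteInner f f ≤ siteInner f (precOpA C Ω A msq a k f))
    (hker : ∀ p q : HiggsLattice.Site P k × Ix N,
      |mat (precOpA C Ω A msq a k) p q| ≤ c₀ * Real.exp (-(δ₀ * (HiggsLattice.Site.tdist p.1 q.1 : ℝ))))
    (Λ : Finset (HiggsLattice.Site P k)) {p q : HiggsLattice.Site P k × Ix N} (hp : p.1 ∈ Λ) (hq : q.1 ∈ Λ) :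
    |mat (deltaCov235 C Ω A msq a k Λ) p q| ≤
      cSt (profile P N) γ₀ c₀ δ₀ *
        Real.exp (-(dSt (profile P N) γ₀ c₀ δ₀ *
          ((HiggsLattice.Site.tdist p.1 q.1 : ℝ) + distC Λ p.1 + distC Λ q.1))) := by
  rw [deltaCov235, condCov232, fluctCovA, mat_sub, Matrix.sub_apply]
  exact restrictInv_sub_inv_decay hγ hc hδ (siteInner_precOpA_comm C Ω A msq a k) hlow hker Λ hp hq

/-- The two precision operators of `Ω ⊂ Ω₀` differ by `Δ^{(k)}(Ω₀,A) − Δ^{(k)}(Ω,A)` (the block term `P(A)` does not see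
`Ω`), in coordinates. [cite: Balaban1983RegularityDecay, (5.5) p.594] -/
theorem mat_precOpA_sub (Ω₀ : Finset (HiggsLattice.Site P 0)) (k : ℕ) :
    mat (precOpA C Ω₀ A msq a k) - mat (precOpA C Ω A msq a k)
      = mat (deltaKA C Ω₀ A msq a k) - mat (deltaKA C Ω A msq a k) := by
  rw [← mat_sub, ← mat_sub, precOpA, precOpA, add_sub_add_left_eq_sub]

/-- **(2.38)-SHAPE FOR THE CONCRETE MODEL, BY THE PRINTED ROUTE OF [13] p. 594** — *"for Ω ⊂ Ω₀ and δC^{(k)}_Λ(Ω, Ω₀, A) =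
C^{(k)}_Λ(Ω, A) − C^{(k)}_Λ(Ω₀, A), (2.37) we have similarly |δC^{(k)}_Λ(Ω, Ω₀, A; x, x′)| ≦ c₀ exp(−δ₀(|x − x′| +
dist(x, Ω^{(k)c}) + dist(x′, Ω^{(k)c}))), x, x′ ∈ Λ. (2.38)"*: for two regions `Ω, Ω₀` (any), GIVEN (5.6) for both
precision operators and the localisation input (5.5) `|(Δ^{(k)}(Ω₀,A) − Δ^{(k)}(Ω,A))(p,q)| ≤ c₀e^{−δ₀(|x_p−x_q| + w(x_p) +
w(x_q))}` with a nonnegative Lipschitz boundary weight `w` (the print's `w = dist(·, Ω^{(k)c})`), the coordinate kernel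
of (2.37) `condCov232 … Ω … Λ − condCov232 … Ω₀ … Λ` obeys (2.38) with that weight and the same `(c₁, δ₁)`.
[cite: Balaban1982Higgs1, Prop. 2.3 (2.37)–(2.38) p.612] -/
theorem ineq238_concrete (Ω₀ : Finset (HiggsLattice.Site P 0)) {γ₀ c₀ δ₀ : ℝ} (hγ : 0 < γ₀) (hc : 0 < c₀)
    (hδ : 0 < δ₀)
    (hlow : ∀ f : ScalarField P k N, γ₀ * siteInner f f ≤ siteInner f (precOpA C Ω A msq a k f))
    (hker : ∀ p q : HiggsLattice.Site P k × Ix N,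
      |mat (precOpA C Ω A msq a k) p q| ≤ c₀ * Real.exp (-(δ₀ * (HiggsLattice.Site.tdist p.1 q.1 : ℝ))))
    (hlow₀ : ∀ f : ScalarField P k N, γ₀ * siteInner f f ≤ siteInner f (precOpA C Ω₀ A msq a k f))
    (hker₀ : ∀ p q : HiggsLattice.Site P k × Ix N,
      |mat (precOpA C Ω₀ A msq a k) p q| ≤ c₀ * Real.exp (-(δ₀ * (HiggsLattice.Site.tdist p.1 q.1 : ℝ))))
    {w : HiggsLattice.Site P k → ℝ} (hw0 : ∀ x, 0 ≤ w x)
    (hwLip : ∀ x y, w x ≤ (HiggsLattice.Site.tdist x y : ℝ) + w y)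
    (hloc : ∀ p q : HiggsLattice.Site P k × Ix N,
      |mat (deltaKA C Ω₀ A msq a k) p q - mat (deltaKA C Ω A msq a k) p q| ≤
        c₀ * Real.exp (-(δ₀ * ((HiggsLattice.Site.tdist p.1 q.1 : ℝ) + w p.1 + w q.1))))
    (Λ : Finset (HiggsLattice.Site P k)) {p q : HiggsLattice.Site P k × Ix N} (hp : p.1 ∈ Λ) (hq : q.1 ∈ Λ) :
    |mat (condCov232 C Ω A msq a k Λ) p q - mat (condCov232 C Ω₀ A msq a k Λ) p q| ≤
      cSt (profile P N) γ₀ c₀ δ₀ *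
        Real.exp (-(dSt (profile P N) γ₀ c₀ δ₀ *
          ((HiggsLattice.Site.tdist p.1 q.1 : ℝ) + w p.1 + w q.1))) := by
  have hdiff : ∀ p q : HiggsLattice.Site P k × Ix N,
      |mat (precOpA C Ω₀ A msq a k : Module.End ℝ (ScalarField P k N)) p q
          - mat (precOpA C Ω A msq a k : Module.End ℝ (ScalarField P k N)) p q| ≤
        c₀ * Real.exp (-(δ₀ * ((HiggsLattice.Site.tdist p.1 q.1 : ℝ) + w p.1 + w q.1))) := by
    intro s t
    have h := congrFun (congrFun (mat_precOpA_sub C Ω A msq a Ω₀ k) s) t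
    simp only [Matrix.sub_apply] at h
    rw [h]
    exact hloc s t
  exact restrictInv_sub_restrictInv_decay hγ hc hδ (siteInner_precOpA_comm C Ω A msq a k) hlow hker
    (siteInner_precOpA_comm C Ω₀ A msq a k) hlow₀ hker₀ hw0 hwLip hdiff Λ hp hq

/-- *"In particular the above inequality holds for C^{(k)}(Ω, A)"* (p. 611): the case `Λ = T^{(k)}` of `ineq234_concrete`
is (2.34) for `C^{(k)}(Ω,A) = B1Eq230FluctCov.fluctCovA` (`HiggsCondCov232.condCov232_univ`).
[cite: Balaban1982Higgs1, Prop. 2.3 (2.34) p.611] -/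
theorem ineq234_fluctCovA {γ₀ c₀ δ₀ : ℝ} (hγ : 0 < γ₀) (hc : 0 < c₀) (hδ : 0 < δ₀)
    (hlow : ∀ f : ScalarField P k N, γ₀ * siteInner f f ≤ siteInner f (precOpA C Ω A msq a k f))
    (hker : ∀ p q : HiggsLattice.Site P k × Ix N,
      |mat (precOpA C Ω A msq a k) p q| ≤ c₀ * Real.exp (-(δ₀ * (HiggsLattice.Site.tdist p.1 q.1 : ℝ))))
    (p q : HiggsLattice.Site P k × Ix N) :
    |mat (fluctCovA C Ω A msq a k) p q| ≤
      cSt (profile P N) γ₀ c₀ δ₀ *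
        Real.exp (-(dSt (profile P N) γ₀ c₀ δ₀ * (HiggsLattice.Site.tdist p.1 q.1 : ℝ))) := by
  rw [← condCov232_univ]
  exact ineq234_concrete C Ω A msq a hγ hc hδ hlow hker Finset.univ (Finset.mem_univ _) (Finset.mem_univ _)

end Concrete

/-! ## §4 The short-range input (5.4) from the block structure of `P(A)` ([13] p. 594)

[Balaban1983RegularityDecay] p. 594 [PDF 24]: *"Finally Corollary 2.3 implies that the considered operator is short-ranged
in the sense that for some δ₀ > 0 |(Δ^{(k)}(Ω,A) + aL^{−2}P(A))(x,x′)| ≦ c₀e^{−δ₀|x−x′|}, x, x′ ∈ Ω^{(k)}, (5.4)"*.  The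
`P(A)`-part of this sentence is kernel arithmetic and is PROVED here for the concrete one-step `P(A) = Q^*(A)Q(A)`
(`B1Eq230FluctCov.blockProjA`): its coordinate kernel is BLOCK-DIAGONAL (`mat_blockProjA_eq_zero`: zero unless the two
sites lie in the same `L`-block of `T^{(k)}`, whose diameter in the distance (1.3) is `≤ L − 1`,
`tdist_le_of_blockOf_eq`) with entries bounded by `1` (`abs_mat_blockProjA_le_one`, from `0 ≤ P(A) ≤ 1`,
`B1Ineq233Upper.siteInner_blockProjA_le`, by polarisation `abs_mat_le_of_form_bounds`), hence
`|P(A)(p,q)| ≤ e^{δ(L−1)}e^{−δ|x_p−x_q|}` for every `δ ≥ 0` (`abs_mat_blockProjA_le`).  Consequently (5.4) for the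
precision operator — the hypothesis `hker` of §3 — FOLLOWS from a decay bound for the kernel of `Δ^{(k)}(Ω,A)` alone
(`hker_precOpA_of_deltaKA`), and for `k ≥ 1` from one for the kernel of `Q_k(A)G^ε_k(Ω,A)Q_k^*(A)` in the solved form
(2.21) (`abs_mat_deltaKA_succ_le`) — the object Corollary 2.3 of [13] is about; (2.34)/(2.36) are restated with
these inputs (`ineq234_concrete_of_deltaKA`, `ineq236_concrete_of_deltaKA`).  The Corollary itself (decay of
`G_k(Ω,A)` for regular `A`) is NOT proved here. -/

open B1Eq27StepAdjoint B1Ineq233Upper HiggsAveraging HiggsFluctMeasure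

section Entry

variable (M : Module.End ℝ (ScalarField P k N))

/-- The coordinate basis vector `e_q` of p35's dictionary has coordinates `δ_q`. [cite: Balaban1982Higgs1, (1.5) p.604] -/
theorem fieldCoord_cb (q : HiggsLattice.Site P k × Ix N) :
    fieldCoord (E N) (HiggsLattice.Site P k) (cb P N k q) = Pi.single q 1 := by
  rw [cb, Module.Basis.coe_ofEquivFun, LinearEquiv.apply_symm_apply]

/-- `e_q` is supported at the site of `q`. [cite: Balaban1982Higgs1, (1.5) p.604] -/
theorem cb_apply_of_ne {q : HiggsLattice.Site P k × Ix N} {y : HiggsLattice.Site P k} (h : y ≠ q.1) :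
    (cb P N k q) y = 0 := by
  have hs : siteCoord (E N) ((cb P N k q) y) = 0 := by
    funext i
    have hne : (y, i) ≠ q := fun h' => h (by rw [← h'])
    have := congrFun (fieldCoord_cb (P := P) (N := N) (k := k) q) (y, i)
    rw [fieldCoord_apply] at this
    rw [this, Pi.single_apply, if_neg hne]
    rfl
  simpa using hs

/-- Entry formula: `(mat M)(p, q) = (M e_q)_p`. [cite: Balaban1982Higgs1, (1.5) p.604] -/
theorem mat_apply (p q : HiggsLattice.Site P k × Ix N) :
    mat M p q = fieldCoord (E N) (HiggsLattice.Site P k) (M (cb P N k q)) p := by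
  rw [mat, LinearMap.toMatrix_apply, cb_repr]

/-- Entry formula, bilinear form: `(mat M)(p, q) = δ_p · (mat M) δ_q`. [cite: Balaban1982Higgs1, (1.5) p.604] -/
theorem mat_apply_eq_dotProduct (X : Matrix (HiggsLattice.Site P k × Ix N) (HiggsLattice.Site P k × Ix N) ℝ)
    (p q : HiggsLattice.Site P k × Ix N) :
    X p q = Pi.single p (1 : ℝ) ⬝ᵥ (X *ᵥ Pi.single q (1 : ℝ)) := by
  rw [single_dotProduct, one_mul, Matrix.mulVec, dotProduct_single, mul_one]

variable {M}

/-- **Entries of a bounded nonnegative symmetric operator** (polarisation): if `M` is symmetric for (1.5) with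
`0 ≤ ⟨f, Mf⟩ ≤ c‖f‖²` for all `f`, then `|(mat M)(p, q)| ≤ c` for all coordinate indices. [cite: Balaban1982Higgs1, (2.33) p.611] -/
theorem abs_mat_le_of_form_bounds {c : ℝ}
    (hsymm : ∀ f g : ScalarField P k N, siteInner f (M g) = siteInner g (M f))
    (h0 : ∀ f : ScalarField P k N, 0 ≤ siteInner f (M f))
    (hc : ∀ f : ScalarField P k N, siteInner f (M f) ≤ c * siteInner f f)
    (p q : HiggsLattice.Site P k × Ix N) : |mat M p q| ≤ c := by
  set X := mat M with hX
  have hw : 0 < (P.mesh k ^ P.d)⁻¹ := inv_pos.mpr (pow_pos (P.mesh_pos k) _)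
  -- the quadratic form of `X` in coordinates
  have hQ0 : ∀ w : HiggsLattice.Site P k × Ix N → ℝ, 0 ≤ w ⬝ᵥ (X *ᵥ w) := fun w => by
    rw [hX, dotProduct_mat_mulVec]
    exact mul_nonneg hw.le (h0 _)
  have hQc : ∀ w : HiggsLattice.Site P k × Ix N → ℝ, w ⬝ᵥ (X *ᵥ w) ≤ c * (w ⬝ᵥ w) := fun w => by
    rw [hX, dotProduct_mat_mulVec, dotProduct_self_eq_siteInner, mul_left_comm]
    exact mul_le_mul_of_nonneg_left (hc _) hw.le
  have hsym : X.IsSymm := mat_isSymm hsymm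
  set u : HiggsLattice.Site P k × Ix N → ℝ := Pi.single p 1 with hu
  set v : HiggsLattice.Site P k × Ix N → ℝ := Pi.single q 1 with hv
  have huu : u ⬝ᵥ u = 1 := by rw [hu, single_dotProduct, one_mul, Pi.single_eq_same]
  have hvv : v ⬝ᵥ v = 1 := by rw [hv, single_dotProduct, one_mul, Pi.single_eq_same]
  have huv0 : 0 ≤ u ⬝ᵥ v := by
    rw [hu, single_dotProduct, one_mul, hv, Pi.single_apply]
    split_ifs <;> norm_num
  have huv1 : u ⬝ᵥ v ≤ 1 := by
    rw [hu, single_dotProduct, one_mul, hv, Pi.single_apply]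
    split_ifs <;> norm_num
  have hpq : X p q = u ⬝ᵥ (X *ᵥ v) := mat_apply_eq_dotProduct X p q
  have hqp : v ⬝ᵥ (X *ᵥ u) = u ⬝ᵥ (X *ᵥ v) := by
    rw [← mat_apply_eq_dotProduct X q p, ← hpq]
    exact hsym.apply p q
  have hvu : v ⬝ᵥ u = u ⬝ᵥ v := dotProduct_comm v u
  -- polarisation
  have hplus : (u + v) ⬝ᵥ (X *ᵥ (u + v)) = u ⬝ᵥ (X *ᵥ u) + v ⬝ᵥ (X *ᵥ v) + 2 * (u ⬝ᵥ (X *ᵥ v)) := by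
    rw [Matrix.mulVec_add, add_dotProduct, dotProduct_add, dotProduct_add, hqp]; ring
  have hminus : (u - v) ⬝ᵥ (X *ᵥ (u - v)) = u ⬝ᵥ (X *ᵥ u) + v ⬝ᵥ (X *ᵥ v) - 2 * (u ⬝ᵥ (X *ᵥ v)) := by
    rw [Matrix.mulVec_sub, sub_dotProduct, dotProduct_sub, dotProduct_sub, hqp]; ring
  have hnp : (u + v) ⬝ᵥ (u + v) = 2 + 2 * (u ⬝ᵥ v) := by
    rw [add_dotProduct, dotProduct_add, dotProduct_add, huu, hvv, hvu]; ring
  have hnm : (u - v) ⬝ᵥ (u - v) = 2 - 2 * (u ⬝ᵥ v) := by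
    rw [sub_dotProduct, dotProduct_sub, dotProduct_sub, huu, hvv, hvu]; ring
  have hcnn : 0 ≤ c := by
    have h1 := hQ0 u
    have h2 := hQc u
    rw [huu, mul_one] at h2
    linarith
  have h1 := hQ0 (u + v)
  have h2 := hQc (u + v)
  have h3 := hQ0 (u - v)
  have h4 := hQc (u - v)
  rw [hplus] at h1 h2
  rw [hminus] at h3 h4
  rw [hnp] at h2
  rw [hnm] at h4
  rw [hpq, abs_le]
  constructor <;> nlinarith

end Entry

section Blocks

variable (C : ChargeData N) (A : HiggsLattice.VecField P 0)

/-- `Q(A)φ` vanishes at a block point `y` when `φ` vanishes on the block `B(y)` ((2.7): the sum runs over `B(y)`).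
[cite: Balaban1982Higgs1, (2.7) p.608] -/
theorem avgQLin_apply_eq_zero {φ : ScalarField P k N} {y : HiggsLattice.Site P (k + 1)}
    (h : ∀ x ∈ HiggsLattice.block y, φ x = 0) : avgQLin C A k φ y = 0 := by
  rw [avgQLin_apply, avgQ_apply, Finset.sum_eq_zero (fun x hx => by rw [h x hx, map_zero]), smul_zero]

/-- `P(A)φ = Q^*(A)Q(A)φ` vanishes at `x` when `φ` vanishes on the block of `x`. [cite: Balaban1982Higgs1, (2.30) p.611] -/
theorem blockProjA_apply_eq_zero {φ : ScalarField P k N} {x : HiggsLattice.Site P k}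
    (h : ∀ x' ∈ HiggsLattice.block (HiggsLattice.blockOf x), φ x' = 0) : blockProjA C A k φ x = 0 := by
  rw [blockProjA, LinearMap.comp_apply, avgQAdjLin_apply, avgQLin_apply_eq_zero C A h, map_zero]

/-- **`P(A)` is block-diagonal**: its coordinate kernel vanishes unless the two sites lie in the same block of
`T^{(k)}`. [cite: Balaban1982Higgs1, (2.30) p.611] -/
theorem mat_blockProjA_eq_zero {p q : HiggsLattice.Site P k × Ix N}
    (h : HiggsLattice.blockOf p.1 ≠ HiggsLattice.blockOf q.1) : mat (blockProjA C A k) p q = 0 := by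
  rw [mat_apply, fieldCoord_apply]
  have hz : blockProjA C A k (cb P N k q) p.1 = 0 := by
    refine blockProjA_apply_eq_zero C A fun x' hx' => cb_apply_of_ne ?_
    intro hEq
    apply h
    simp only [HiggsLattice.block, Finset.mem_filter, Finset.mem_univ, true_and] at hx'
    rw [← hx', hEq]
  rw [hz, map_zero]
  rfl

/-- The site counts of consecutive lattices: `2L^{K−k}ML′_μ ≤ L · 2L^{K−k−1}ML′_μ` (equality for `k < K`).
[cite: Balaban1982Higgs1, (1.20) p.607] -/
theorem sitesPerDir_le_mul_succ (k : ℕ) (μ : Fin P.d) : P.sitesPerDir k μ ≤ P.L * P.sitesPerDir (k + 1) μ := by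
  unfold HiggsLattice.Params.sitesPerDir
  have hL : 1 ≤ P.L := P.hL
  have hpow : P.L ^ (P.K - k) ≤ P.L * P.L ^ (P.K - (k + 1)) := by
    calc P.L ^ (P.K - k) ≤ P.L ^ (P.K - k - 1 + 1) := Nat.pow_le_pow_right hL le_tsub_add
      _ = P.L * P.L ^ (P.K - (k + 1)) := by rw [pow_succ, mul_comm, Nat.sub_sub]
  calc 2 * (P.L ^ (P.K - k) * P.M * P.Lp μ) ≤ 2 * (P.L * P.L ^ (P.K - (k + 1)) * P.M * P.Lp μ) := by gcongr
    _ = P.L * (2 * (P.L ^ (P.K - (k + 1)) * P.M * P.Lp μ)) := by ring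

/-- Two sites in the same block ((1.17): `blockOf` = coordinatewise integer division by `L`) have equal coordinate
quotients. [cite: Balaban1982Higgs1, (1.17) p.606] -/
theorem val_div_eq_of_blockOf_eq {x y : HiggsLattice.Site P k} (h : HiggsLattice.blockOf x = HiggsLattice.blockOf y)
    (μ : Fin P.d) : (x μ).val / P.L = (y μ).val / P.L := by
  have hμ := congrFun h μ
  unfold HiggsLattice.blockOf at hμ
  have hlt : ∀ z : HiggsLattice.Site P k, (z μ).val / P.L < P.sitesPerDir (k + 1) μ := fun z =>
    (Nat.div_lt_iff_lt_mul P.hL).mpr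
      (lt_of_lt_of_le (ZMod.val_lt (z μ)) (by rw [mul_comm]; exact sitesPerDir_le_mul_succ k μ))
  have := (ZMod.natCast_eq_natCast_iff' _ _ _).mp hμ
  rwa [Nat.mod_eq_of_lt (hlt x), Nat.mod_eq_of_lt (hlt y)] at this

/-- Naturals with the same quotient by `L` differ by at most `L − 1`. [folklore] -/
private theorem sub_le_of_div_eq {a b L : ℕ} (hL : 0 < L) (h : a / L = b / L) : a - b ≤ L - 1 := by
  have h1 : a < a / L * L + L := Nat.lt_div_mul_add hL
  have h2 : b / L * L ≤ b := Nat.div_mul_le_self b L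
  rw [h] at h1
  omega

/-- **A block of `T^{(k)}` has diameter `≤ L − 1` in the distance (1.3)** (lattice units). [cite: Balaban1982Higgs1, (1.17) p.606] -/
theorem tdist_le_of_blockOf_eq {x y : HiggsLattice.Site P k} (h : HiggsLattice.blockOf x = HiggsLattice.blockOf y) :
    HiggsLattice.Site.tdist x y ≤ P.L - 1 := by
  unfold HiggsLattice.Site.tdist
  refine Finset.sup_le fun μ _ => ?_
  have hq := val_div_eq_of_blockOf_eq h μ
  by_cases hle : (y μ).val ≤ (x μ).val
  · calc min (x μ - y μ).val (y μ - x μ).val ≤ (x μ - y μ).val := min_le_left _ _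
      _ = (x μ).val - (y μ).val := ZMod.val_sub hle
      _ ≤ P.L - 1 := sub_le_of_div_eq P.hL hq
  · have hle' : (x μ).val ≤ (y μ).val := (not_le.mp hle).le
    calc min (x μ - y μ).val (y μ - x μ).val ≤ (y μ - x μ).val := min_le_right _ _
      _ = (y μ).val - (x μ).val := ZMod.val_sub hle'
      _ ≤ P.L - 1 := sub_le_of_div_eq P.hL hq.symm

/-- The same in real form: `|x − y| ≤ L − 1`. [cite: Balaban1982Higgs1, (1.17) p.606] -/
theorem tdist_le_of_blockOf_eq_real {x y : HiggsLattice.Site P k}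
    (h : HiggsLattice.blockOf x = HiggsLattice.blockOf y) :
    (HiggsLattice.Site.tdist x y : ℝ) ≤ (P.L : ℝ) - 1 := by
  have h1 := tdist_le_of_blockOf_eq h
  have hL : 1 ≤ P.L := P.hL
  have : ((P.L - 1 : ℕ) : ℝ) = (P.L : ℝ) - 1 := by rw [Nat.cast_sub hL, Nat.cast_one]
  rw [← this]
  exact_mod_cast h1

/-- **`|P(A)(p, q)| ≤ 1`** for EVERY external field `A`, every coupling, `k < K`: from `0 ≤ P(A) ≤ 1`
(`B1Eq230FluctCovPos.siteInner_blockProjA_nonneg`, `B1Ineq233Upper.siteInner_blockProjA_le`) by polarisation.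
[cite: Balaban1982Higgs1, (2.33) p.611] -/
theorem abs_mat_blockProjA_le_one (hk : k < P.K) (p q : HiggsLattice.Site P k × Ix N) :
    |mat (blockProjA C A k) p q| ≤ 1 :=
  abs_mat_le_of_form_bounds (siteInner_blockProjA_comm C A k) (siteInner_blockProjA_nonneg C A k)
    (fun f => by rw [one_mul]; exact siteInner_blockProjA_le C A hk f) p q

/-- **The kernel of `P(A)` is short-ranged with ANY rate**: `|P(A)(p, q)| ≤ e^{δ(L−1)}·e^{−δ|x_p − x_q|}` for every
`δ ≥ 0`, every `A`, `k < K` (block-diagonal with entries `≤ 1`, blocks of diameter `≤ L − 1`) — the `P(A)`-part of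
(5.4). [cite: Balaban1983RegularityDecay, (5.4) p.594] -/
theorem abs_mat_blockProjA_le (hk : k < P.K) {δ : ℝ} (hδ : 0 ≤ δ) (p q : HiggsLattice.Site P k × Ix N) :
    |mat (blockProjA C A k) p q| ≤
      Real.exp (δ * ((P.L : ℝ) - 1)) * Real.exp (-(δ * (HiggsLattice.Site.tdist p.1 q.1 : ℝ))) := by
  by_cases h : HiggsLattice.blockOf p.1 = HiggsLattice.blockOf q.1
  · have ht := tdist_le_of_blockOf_eq_real h
    calc |mat (blockProjA C A k) p q| ≤ 1 := abs_mat_blockProjA_le_one C A hk p q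
      _ ≤ Real.exp (δ * ((P.L : ℝ) - 1) + -(δ * (HiggsLattice.Site.tdist p.1 q.1 : ℝ))) :=
          Real.one_le_exp (by nlinarith)
      _ = _ := Real.exp_add _ _
  · rw [mat_blockProjA_eq_zero C A h, abs_zero]
    positivity

variable (Ω : Finset (HiggsLattice.Site P 0)) (msq a : ℝ)

/-- **(5.4) for `a(L^{k+1}ε)^{−2}P(A) + Δ^{(k)}(Ω,A)` from a decay bound for the kernel of `Δ^{(k)}(Ω,A)` alone**
(`a ≥ 0`, `k < K`): `|Δ^{(k)}(Ω,A)(p,q)| ≤ c·e^{−δ|x_p−x_q|}` ⇒ the precision operator obeys (5.4) with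
`c₀ = a(L^{k+1}ε)^{−2}e^{δ(L−1)} + c` and the same `δ`. [cite: Balaban1983RegularityDecay, (5.4) p.594] -/
theorem hker_precOpA_of_deltaKA (hk : k < P.K) (ha : 0 ≤ a) {c δ : ℝ} (hδ : 0 ≤ δ)
    (hΔ : ∀ p q : HiggsLattice.Site P k × Ix N,
      |mat (deltaKA C Ω A msq a k) p q| ≤ c * Real.exp (-(δ * (HiggsLattice.Site.tdist p.1 q.1 : ℝ))))
    (p q : HiggsLattice.Site P k × Ix N) :
    |mat (precOpA C Ω A msq a k) p q| ≤
      (a * ((P.mesh (k + 1))⁻¹ ^ 2) * Real.exp (δ * ((P.L : ℝ) - 1)) + c) *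
        Real.exp (-(δ * (HiggsLattice.Site.tdist p.1 q.1 : ℝ))) := by
  have hcoef : 0 ≤ a * ((P.mesh (k + 1))⁻¹ ^ 2) := mul_nonneg ha (sq_nonneg _)
  rw [precOpA, mat_add, mat_smul, Matrix.add_apply, Matrix.smul_apply, smul_eq_mul]
  calc |a * ((P.mesh (k + 1))⁻¹ ^ 2) * mat (blockProjA C A k) p q + mat (deltaKA C Ω A msq a k) p q|
      ≤ |a * ((P.mesh (k + 1))⁻¹ ^ 2) * mat (blockProjA C A k) p q| + |mat (deltaKA C Ω A msq a k) p q| :=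
        abs_add_le _ _
    _ = a * ((P.mesh (k + 1))⁻¹ ^ 2) * |mat (blockProjA C A k) p q| + |mat (deltaKA C Ω A msq a k) p q| := by
        rw [abs_mul, abs_of_nonneg hcoef]
    _ ≤ a * ((P.mesh (k + 1))⁻¹ ^ 2) *
          (Real.exp (δ * ((P.L : ℝ) - 1)) * Real.exp (-(δ * (HiggsLattice.Site.tdist p.1 q.1 : ℝ)))) +
        c * Real.exp (-(δ * (HiggsLattice.Site.tdist p.1 q.1 : ℝ))) :=
        add_le_add (mul_le_mul_of_nonneg_left (abs_mat_blockProjA_le C A hk hδ p q) hcoef) (hΔ p q)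
    _ = _ := by ring

/-- The distance (1.3) of a site to itself is `0`. [cite: Balaban1982Higgs1, (1.3) p.604] -/
theorem tdist_self (x : HiggsLattice.Site P k) : HiggsLattice.Site.tdist x x = 0 := by
  unfold HiggsLattice.Site.tdist
  apply Nat.le_zero.mp
  exact Finset.sup_le fun μ _ => by simp

/-- **For `k ≥ 1`, via the solved form (2.21)**: a decay bound `|(Q_k(A)G^ε_k(Ω,A)Q_k^*(A))(p,q)| ≤ c·e^{−δ|x_p−x_q|}`
for the kernel of the block-averaged propagator — the object Corollary 2.3 of [13] controls — gives
`|Δ^{(k),L^kε}(Ω,A)(p,q)| ≤ (a_k(L^kε)^{−2} + (a_k(L^kε)^{−2})²·c)·e^{−δ|x_p−x_q|}`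
(`Δ^{(k)} = a_k(L^kε)^{−2}·1 − (a_k(L^kε)^{−2})²·Q_kG^ε_kQ_k^*`, `B1Eq230FluctCov.deltaKA_succ`; the identity part is
diagonal). [cite: Balaban1982Higgs1, (2.21) p.610] -/
theorem abs_mat_deltaKA_succ_le (j : ℕ) {c δ : ℝ}
    (hQGQ : ∀ p q : HiggsLattice.Site P (j + 1) × Ix N,
      |mat (avgQkLin C A (j + 1) ∘ₗ propagatorK C Ω A msq a (j + 1) ∘ₗ avgQkAdj C A (j + 1)) p q| ≤
        c * Real.exp (-(δ * (HiggsLattice.Site.tdist p.1 q.1 : ℝ))))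
    (p q : HiggsLattice.Site P (j + 1) × Ix N) :
    |mat (deltaKA C Ω A msq a (j + 1)) p q| ≤
      (|coeff221 P a (j + 1)| + coeff221 P a (j + 1) ^ 2 * c) *
        Real.exp (-(δ * (HiggsLattice.Site.tdist p.1 q.1 : ℝ))) := by
  rw [deltaKA_succ, mat_sub, mat_smul, mat_smul, mat_id, Matrix.sub_apply, Matrix.smul_apply, Matrix.smul_apply,
    smul_eq_mul, smul_eq_mul]
  have hid : |coeff221 P a (j + 1) * (1 : Matrix _ _ ℝ) p q| ≤
      |coeff221 P a (j + 1)| * Real.exp (-(δ * (HiggsLattice.Site.tdist p.1 q.1 : ℝ))) := by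
    rw [abs_mul]
    refine mul_le_mul_of_nonneg_left ?_ (abs_nonneg _)
    by_cases hpq : p = q
    · subst hpq
      rw [Matrix.one_apply_eq, abs_one, tdist_self, Nat.cast_zero, mul_zero, neg_zero, Real.exp_zero]
    · rw [Matrix.one_apply_ne hpq, abs_zero]
      positivity
  have hsq : 0 ≤ coeff221 P a (j + 1) ^ 2 := sq_nonneg _
  calc |coeff221 P a (j + 1) * (1 : Matrix _ _ ℝ) p q -
        coeff221 P a (j + 1) ^ 2 *
          mat (avgQkLin C A (j + 1) ∘ₗ propagatorK C Ω A msq a (j + 1) ∘ₗ avgQkAdj C A (j + 1)) p q|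
      ≤ |coeff221 P a (j + 1) * (1 : Matrix _ _ ℝ) p q| +
        |coeff221 P a (j + 1) ^ 2 *
          mat (avgQkLin C A (j + 1) ∘ₗ propagatorK C Ω A msq a (j + 1) ∘ₗ avgQkAdj C A (j + 1)) p q| :=
        abs_sub _ _
    _ ≤ |coeff221 P a (j + 1)| * Real.exp (-(δ * (HiggsLattice.Site.tdist p.1 q.1 : ℝ))) +
        coeff221 P a (j + 1) ^ 2 * (c * Real.exp (-(δ * (HiggsLattice.Site.tdist p.1 q.1 : ℝ)))) := by
        refine add_le_add hid ?_
        rw [abs_mul, abs_of_nonneg hsq]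
        exact mul_le_mul_of_nonneg_left (hQGQ p q) hsq
    _ = _ := by ring

end Blocks

section ConcreteOfDelta

variable (C : ChargeData N) (Ω : Finset (HiggsLattice.Site P 0)) (A : HiggsLattice.VecField P 0) (msq a : ℝ)

/-- **(2.34) for the concrete `C^{(k)}_Λ(Ω,A)` with the inputs in the form [13] p. 594 states them**: the lower half
(2.33)ₗ `γ₀‖f‖² ≤ ⟨f, (a(L^{k+1}ε)^{−2}P(A) + Δ^{(k)}(Ω,A))f⟩` and a short-range bound for the kernel of `Δ^{(k)}(Ω,A)`
ALONE, `|Δ^{(k)}(Ω,A)(p,q)| ≤ c·e^{−δ₀|x_p−x_q|}` (⇐ Corollary 2.3 of [13]); the `P(A)`-part of (5.4) is supplied by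
`abs_mat_blockProjA_le` (`a ≥ 0`, `k < K`).  Constants `(cSt, dSt)(N·K_d; γ₀, a(L^{k+1}ε)^{−2}e^{δ₀(L−1)} + c, δ₀)`.
[cite: Balaban1982Higgs1, Prop. 2.3 (2.34) p.611] -/
theorem ineq234_concrete_of_deltaKA (hk : k < P.K) (ha : 0 ≤ a) {γ₀ c δ₀ : ℝ} (hγ : 0 < γ₀) (hc : 0 < c)
    (hδ : 0 < δ₀)
    (hlow : ∀ f : ScalarField P k N, γ₀ * siteInner f f ≤ siteInner f (precOpA C Ω A msq a k f))
    (hΔ : ∀ p q : HiggsLattice.Site P k × Ix N,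
      |mat (deltaKA C Ω A msq a k) p q| ≤ c * Real.exp (-(δ₀ * (HiggsLattice.Site.tdist p.1 q.1 : ℝ))))
    (Λ : Finset (HiggsLattice.Site P k)) {p q : HiggsLattice.Site P k × Ix N} (hp : p.1 ∈ Λ) (hq : q.1 ∈ Λ) :
    |mat (condCov232 C Ω A msq a k Λ) p q| ≤
      cSt (profile P N) γ₀ (a * ((P.mesh (k + 1))⁻¹ ^ 2) * Real.exp (δ₀ * ((P.L : ℝ) - 1)) + c) δ₀ *
        Real.exp (-(dSt (profile P N) γ₀ (a * ((P.mesh (k + 1))⁻¹ ^ 2) * Real.exp (δ₀ * ((P.L : ℝ) - 1)) + c) δ₀ *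
          (HiggsLattice.Site.tdist p.1 q.1 : ℝ))) :=
  ineq234_concrete C Ω A msq a hγ
    (add_pos_of_nonneg_of_pos (mul_nonneg (mul_nonneg ha (sq_nonneg _)) (Real.exp_pos _).le) hc) hδ hlow
    (hker_precOpA_of_deltaKA C A Ω msq a hk ha hδ.le hΔ) Λ hp hq

/-- **(2.36) for the concrete `δC^{(k)}_Λ(Ω,A)` with the same inputs** ((2.33)ₗ + decay of the kernel of
`Δ^{(k)}(Ω,A)` alone). [cite: Balaban1982Higgs1, Prop. 2.3 (2.36) p.612] -/
theorem ineq236_concrete_of_deltaKA (hk : k < P.K) (ha : 0 ≤ a) {γ₀ c δ₀ : ℝ} (hγ : 0 < γ₀) (hc : 0 < c)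
    (hδ : 0 < δ₀)
    (hlow : ∀ f : ScalarField P k N, γ₀ * siteInner f f ≤ siteInner f (precOpA C Ω A msq a k f))
    (hΔ : ∀ p q : HiggsLattice.Site P k × Ix N,
      |mat (deltaKA C Ω A msq a k) p q| ≤ c * Real.exp (-(δ₀ * (HiggsLattice.Site.tdist p.1 q.1 : ℝ))))
    (Λ : Finset (HiggsLattice.Site P k)) {p q : HiggsLattice.Site P k × Ix N} (hp : p.1 ∈ Λ) (hq : q.1 ∈ Λ) :
    |mat (deltaCov235 C Ω A msq a k Λ) p q| ≤
      cSt (profile P N) γ₀ (a * ((P.mesh (k + 1))⁻¹ ^ 2) * Real.exp (δ₀ * ((P.L : ℝ) - 1)) + c) δ₀ *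
        Real.exp (-(dSt (profile P N) γ₀ (a * ((P.mesh (k + 1))⁻¹ ^ 2) * Real.exp (δ₀ * ((P.L : ℝ) - 1)) + c) δ₀ *
          ((HiggsLattice.Site.tdist p.1 q.1 : ℝ) + distC Λ p.1 + distC Λ q.1))) :=
  ineq236_concrete C Ω A msq a hγ
    (add_pos_of_nonneg_of_pos (mul_nonneg (mul_nonneg ha (sq_nonneg _)) (Real.exp_pos _).le) hc) hδ hlow
    (hker_precOpA_of_deltaKA C A Ω msq a hk ha hδ.le hΔ) Λ hp hq

end ConcreteOfDelta


/-! ## §5 (5.4) for `k ≥ 1` from the PAIRING SHAPE of [13] Corollary 2.3 for `G_k(Ω,A)` (v1.2)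

[Balaban1983RegularityDecay] Corollary 2.3 (2.30) p. 580 bounds the pairings `|⟨f, G_k(Ω,A)f′⟩| ≤
c₀e^{−δ₀dist(supp f, supp f′)}‖f‖₂‖f′‖₂`; p. 594 then says *"Corollary 2.3 implies that the considered operator is
short-ranged … (5.4)"*.  For the concrete operators this implication is kernel arithmetic and is PROVED here: by the
adjointness of `Q_k(A)`, `Q_k^*(A)` for the products (1.5) (`HiggsCovariancePos.siteInner_avgQkLin`) the coordinate kernel
of `Q_k(A)G Q_k^*(A)` is a pairing of `G` between the block-localised test fields `Q_k^*(A)e_p`, `Q_k^*(A)e_q`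
(`mat_QGQ_eq`; supports in `B^k(x_p)`, `B^k(x_q)`: `avgQkAdj_cb_eq_zero`; (1.5)-norms² `= (L^kε)^d`: `siteInner_avgQkAdj_cb`,
from `Q_kQ_k^* = 1`), so a pairing bound for block-localised fields with the block-label distance gives
`|(Q_kGQ_k^*)(p,q)| ≤ c₀e^{−δ₀|x_p−x_q|}` (`abs_mat_QGQ_le`); two blocks `B^k(y)`, `B^k(y′)` of `T_ε` are
`≥ L^k|y − y′| − (L^k − 1)` apart in the distance (1.3) of `T_ε` (`mul_tdist_blockIter_le`, `k ≤ K`), so the printed shape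
with `dist(supp f, supp f′)` measured in units of `T^{(k)}` implies the block form with `c₀ ↦ c₀e^{δ₀}`
(`pairing_block_of_sep`); whence (5.4) for the precision operator at level `k ≥ 1` (`hker_precOpA_succ_of_sep`, with §4)
and (2.34)/(2.36) for the concrete `C^{(k)}_Λ(Ω,A)`, `δC^{(k)}_Λ(Ω,A)`, `k ≥ 1`, from (2.33)ₗ + the Corollary-2.3 shape for
`G^ε_k(Ω,A) = HiggsCovariance.propagatorK` (`ineq234_concrete_of_sep`, `ineq236_concrete_of_sep`).  Corollary 2.3 itself is
NOT proved here. -/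

section Pairing

variable (C : ChargeData N) (A : HiggsLattice.VecField P 0)

/-- Pointwise formula of `Q_k^*(A)`: `(Q_k^*(A)ψ)(x) = U(A(Γ^{(k)}_{x_k,x}))^*ψ(x_k)` (unfolding of `HiggsCovariance.avgQkAdj`).
[cite: Balaban1982Higgs1, (2.20) p.610] -/
theorem avgQkAdj_apply' (ψ : ScalarField P k N) (x : HiggsLattice.Site P 0) :
    avgQkAdj C A k ψ x = star (C.U (P.mesh 0) (multiContourSum A k x)) (ψ (blockIter k x)) := by
  simp [avgQkAdj]

/-- `Q_k^*(A)e_q` is supported in the block `B^k(x_q)`. [cite: Balaban1982Higgs1, (2.20) p.610] -/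
theorem avgQkAdj_cb_eq_zero (q : HiggsLattice.Site P k × Ix N) {x : HiggsLattice.Site P 0} (hx : blockIter k x ≠ q.1) :
    avgQkAdj C A k (cb P N k q) x = 0 := by
  rw [avgQkAdj_apply', cb_apply_of_ne hx, map_zero]

/-- `e_q = fieldCoord⁻¹(δ_q)`. [cite: Balaban1982Higgs1, (1.5) p.604] -/
theorem fieldCoord_symm_single (q : HiggsLattice.Site P k × Ix N) :
    (fieldCoord (E N) (HiggsLattice.Site P k)).symm (Pi.single q 1) = cb P N k q := by
  rw [LinearEquiv.symm_apply_eq, fieldCoord_cb]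

/-- `‖e_q‖² = (L^kε)^d` for (1.5). [cite: Balaban1982Higgs1, (1.5) p.604] -/
theorem siteInner_cb_self (q : HiggsLattice.Site P k × Ix N) : siteInner (cb P N k q) (cb P N k q) = P.mesh k ^ P.d := by
  rw [siteInner_eq_dotProduct, fieldCoord_cb, single_dotProduct, one_mul, Pi.single_eq_same, mul_one]

/-- **`‖Q_k^*(A)e_q‖² = (L^kε)^d`** (`⟨Q_k^*e, Q_k^*e⟩ = ⟨e, Q_kQ_k^*e⟩ = ⟨e, e⟩`, `Q_kQ_k^* = 1` for `k ≤ K`,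
`B1Eq27StepAdjoint.avgQkLin_comp_avgQkAdj`). [cite: Balaban1982Higgs1, (2.20) p.610] -/
theorem siteInner_avgQkAdj_cb (hk : k ≤ P.K) (q : HiggsLattice.Site P k × Ix N) :
    siteInner (avgQkAdj C A k (cb P N k q)) (avgQkAdj C A k (cb P N k q)) = P.mesh k ^ P.d := by
  rw [← siteInner_avgQkLin, ← LinearMap.comp_apply, avgQkLin_comp_avgQkAdj C A hk, LinearMap.id_apply,
    siteInner_cb_self]

variable (G : Module.End ℝ (ScalarField P 0 N))

/-- **The kernel of `Q_k(A)GQ_k^*(A)` is a pairing of `G` between block-localised fields**: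
`(Q_kGQ_k^*)(p, q) = (L^kε)^{−d}⟨Q_k^*e_p, G Q_k^*e_q⟩_{T_ε}`. [cite: Balaban1982Higgs1, (2.21) p.610] -/
theorem mat_QGQ_eq (p q : HiggsLattice.Site P k × Ix N) :
    mat (avgQkLin C A k ∘ₗ G ∘ₗ avgQkAdj C A k) p q
      = (P.mesh k ^ P.d)⁻¹ * siteInner (avgQkAdj C A k (cb P N k p)) (G (avgQkAdj C A k (cb P N k q))) := by
  rw [mat_apply_eq_dotProduct (mat (avgQkLin C A k ∘ₗ G ∘ₗ avgQkAdj C A k)) p q, dotProduct_mat_mulVec,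
    fieldCoord_symm_single, fieldCoord_symm_single, LinearMap.comp_apply, LinearMap.comp_apply,
    siteInner_comm (cb P N k p), siteInner_avgQkLin, siteInner_comm]

/-- **`|(Q_kGQ_k^*)(p, q)| ≤ c₀e^{−δ₀|x_p − x_q|}`** from a pairing bound of `G` for fields localised in two blocks
`B^k(y)`, `B^k(y′)` with the block-label distance: `|⟨g, Gg′⟩| ≤ c₀e^{−δ₀|y − y′|}‖g‖‖g′‖` (`k ≤ K`).
[cite: Balaban1983RegularityDecay, Cor. 2.3 (2.30) p.580] -/
theorem abs_mat_QGQ_le (hk : k ≤ P.K) {c₀ δ₀ : ℝ}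
    (hCor : ∀ (y y' : HiggsLattice.Site P k) (g g' : ScalarField P 0 N),
      (∀ x, blockIter k x ≠ y → g x = 0) → (∀ x, blockIter k x ≠ y' → g' x = 0) →
        |siteInner g (G g')| ≤ c₀ * Real.exp (-(δ₀ * (HiggsLattice.Site.tdist y y' : ℝ))) *
          Real.sqrt (siteInner g g) * Real.sqrt (siteInner g' g'))
    (p q : HiggsLattice.Site P k × Ix N) :
    |mat (avgQkLin C A k ∘ₗ G ∘ₗ avgQkAdj C A k) p q| ≤
      c₀ * Real.exp (-(δ₀ * (HiggsLattice.Site.tdist p.1 q.1 : ℝ))) := by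
  have hw : 0 < P.mesh k ^ P.d := pow_pos (P.mesh_pos k) _
  have h := hCor p.1 q.1 (avgQkAdj C A k (cb P N k p)) (avgQkAdj C A k (cb P N k q))
    (fun x hx => avgQkAdj_cb_eq_zero C A p hx) (fun x hx => avgQkAdj_cb_eq_zero C A q hx)
  rw [siteInner_avgQkAdj_cb C A hk, siteInner_avgQkAdj_cb C A hk, mul_assoc,
    Real.mul_self_sqrt hw.le] at h
  rw [mat_QGQ_eq, abs_mul, abs_of_pos (inv_pos.mpr hw)]
  calc (P.mesh k ^ P.d)⁻¹ * |siteInner (avgQkAdj C A k (cb P N k p)) (G (avgQkAdj C A k (cb P N k q)))|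
      ≤ (P.mesh k ^ P.d)⁻¹ * (c₀ * Real.exp (-(δ₀ * (HiggsLattice.Site.tdist p.1 q.1 : ℝ))) * (P.mesh k ^ P.d)) :=
        mul_le_mul_of_nonneg_left h (inv_pos.mpr hw).le
    _ = c₀ * Real.exp (-(δ₀ * (HiggsLattice.Site.tdist p.1 q.1 : ℝ))) := by
        field_simp

end Pairing

/-! ### The geometry: two blocks `B^k(y)`, `B^k(y′)` of `T_ε` are `≥ L^k|y − y′| − (L^k − 1)` apart -/

section BlockGeometry

/-- `|T_ε|_μ = L^k·|T^{(k)}|_μ` for `k ≤ K` ((1.2)/(1.19): `ε^{−1}L_μ = L^KML′_μ`; = p15's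
`B2Ineq329ZeroAveraging.sitesPerDir_zero_eq`, re-derived here to keep this file's import closure small). [cite: Balaban1982Higgs1, (1.19) p.607] -/
private theorem sitesPerDir_zero_eq' (hk : k ≤ P.K) (μ : Fin P.d) :
    P.sitesPerDir 0 μ = P.L ^ k * P.sitesPerDir k μ := by
  unfold HiggsLattice.Params.sitesPerDir
  have h : P.K - 0 = k + (P.K - k) := by omega
  rw [h, pow_add]
  ring

/-- The label of a block point: `(x_1)_μ = ⌊x_μ/L⌋` at EVERY level (the quotient is always a valid label,
`sitesPerDir_le_mul_succ`; for `k < K` this is p35's `B1Eq214Concrete.val_blockOf`). [cite: Balaban1982Higgs1, (1.17) p.606] -/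
theorem val_blockOf_all (x : HiggsLattice.Site P k) (μ : Fin P.d) :
    ((HiggsLattice.blockOf x) μ).val = (x μ).val / P.L := by
  simp only [HiggsLattice.blockOf]
  rw [ZMod.val_natCast, Nat.mod_eq_of_lt]
  exact (Nat.div_lt_iff_lt_mul P.hL).mpr
    (lt_of_lt_of_le (ZMod.val_lt _) (by rw [mul_comm]; exact sitesPerDir_le_mul_succ k μ))

/-- The label of the iterated block point: `(x_k)_μ = ⌊x_μ/L^k⌋` at EVERY `k` (p. 608 *"x ∈ B^j(x_j)"*; for `k ≤ K` this
is p15's `B2Ineq329ZeroAveraging.val_blockIter`). [cite: Balaban1982Higgs1, (1.20) p.607] -/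
theorem val_blockIter_all : ∀ (k : ℕ) (x : HiggsLattice.Site P 0) (μ : Fin P.d),
    ((blockIter k x) μ).val = (x μ).val / P.L ^ k
  | 0, x, μ => by
    show (x μ).val = (x μ).val / P.L ^ 0
    rw [pow_zero, Nat.div_one]
  | k + 1, x, μ => by
    show ((HiggsLattice.blockOf (blockIter k x)) μ).val = (x μ).val / P.L ^ (k + 1)
    rw [val_blockOf_all, val_blockIter_all k x μ, pow_succ, Nat.div_div_eq_div_mul]

/-- `(b − a) mod n = n − ((a − b) mod n)` for `a ≠ b` in `ℤ/nℤ`. [folklore] -/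
private theorem val_sub_rev {n : ℕ} [NeZero n] {a b : ZMod n} (h : a ≠ b) : (b - a).val = n - (a - b).val := by
  rw [← neg_sub, ZMod.neg_val, if_neg (sub_ne_zero.mpr h)]

/-- One coordinate, one orientation: for labels `a ≥ b` of `ℤ/Tmℤ` with quotients `A = ⌊a/T⌋`, `B = ⌊b/T⌋` in `ℤ/mℤ`,
`T·dist(A − B, mℤ) ≤ dist(a − b, Tmℤ) + (T − 1)`. [folklore] -/
private theorem circ_scale_le_aux {n m T : ℕ} [NeZero n] [NeZero m] (hn : n = T * m) (hT : 0 < T)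
    (a b : ZMod n) (A B : ZMod m) (hA : A.val = a.val / T) (hB : B.val = b.val / T) (hba : b.val ≤ a.val) :
    T * min (A - B).val (B - A).val ≤ min (a - b).val (b - a).val + (T - 1) := by
  have hBA : B.val ≤ A.val := by rw [hA, hB]; exact Nat.div_le_div_right hba
  have hA1 : T * A.val ≤ a.val := by rw [hA, mul_comm]; exact Nat.div_mul_le_self _ _
  have hA2 : a.val < T * A.val + T := by rw [hA, mul_comm]; exact Nat.lt_div_mul_add hT
  have hB1 : T * B.val ≤ b.val := by rw [hB, mul_comm]; exact Nat.div_mul_le_self _ _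
  have hB2 : b.val < T * B.val + T := by rw [hB, mul_comm]; exact Nat.lt_div_mul_add hT
  have hp : T * B.val ≤ T * A.val := Nat.mul_le_mul_left _ hBA
  have hsubA : (A - B).val = A.val - B.val := ZMod.val_sub hBA
  have hsuba : (a - b).val = a.val - b.val := ZMod.val_sub hba
  have hmval : A.val < m := ZMod.val_lt A
  by_cases hAB : A = B
  · subst hAB
    simp
  · have hab : a ≠ b := by
      rintro rfl
      exact hAB (ZMod.val_injective _ (by rw [hA, hB]))
    rw [val_sub_rev hAB, val_sub_rev hab, hsubA, hsuba]
    have h1 : T * (A.val - B.val) ≤ (a.val - b.val) + (T - 1) := by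
      rw [mul_tsub]; omega
    have h2 : T * (m - (A.val - B.val)) ≤ (n - (a.val - b.val)) + (T - 1) := by
      rw [mul_tsub, mul_tsub, ← hn]; omega
    rw [← min_add_add_right]
    exact le_min (le_trans (Nat.mul_le_mul_left _ (min_le_left _ _)) h1)
      (le_trans (Nat.mul_le_mul_left _ (min_le_right _ _)) h2)

/-- One coordinate: `T·dist(A − B, mℤ) ≤ dist(a − b, Tmℤ) + (T − 1)` for `A = ⌊a/T⌋`, `B = ⌊b/T⌋`. [folklore] -/
private theorem circ_scale_le {n m T : ℕ} [NeZero n] [NeZero m] (hn : n = T * m) (hT : 0 < T)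
    (a b : ZMod n) (A B : ZMod m) (hA : A.val = a.val / T) (hB : B.val = b.val / T) :
    T * min (A - B).val (B - A).val ≤ min (a - b).val (b - a).val + (T - 1) := by
  rcases le_total b.val a.val with hba | hab
  · exact circ_scale_le_aux hn hT a b A B hA hB hba
  · rw [min_comm (A - B).val, min_comm (a - b).val]
    exact circ_scale_le_aux hn hT b a B A hB hA hab

/-- **Two blocks of `T_ε` are far apart when their labels are**: for `x ∈ B^k(y)`, `x′ ∈ B^k(y′)` (`y = x_k`, `y′ = x′_k`,
`k ≤ K`), `L^k·|y − y′|_{T^{(k)}} ≤ |x − x′|_{T_ε} + (L^k − 1)` in the lattice-unit distances (1.3) of `T^{(k)}` and `T_ε`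
(i.e. `dist(B^k(y), B^k(y′)) ≥ |y − y′| − 1 + L^{−k}` in units of `T^{(k)}`; p15's `val_blockIter`: `(x_k)_μ = ⌊x_μ/L^k⌋`).
[cite: Balaban1982Higgs1, (1.20) p.607] -/
theorem mul_tdist_blockIter_le (hk : k ≤ P.K) (x x' : HiggsLattice.Site P 0) :
    P.L ^ k * HiggsLattice.Site.tdist (blockIter k x) (blockIter k x') ≤ HiggsLattice.Site.tdist x x' + (P.L ^ k - 1) := by
  have hT : 0 < P.L ^ k := pow_pos P.hL k
  haveI : Nonempty (Fin P.d) := ⟨⟨0, P.hd⟩⟩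
  obtain ⟨μ, -, hμ⟩ := Finset.exists_mem_eq_sup (Finset.univ : Finset (Fin P.d)) Finset.univ_nonempty
    (fun μ : Fin P.d => min ((blockIter k x) μ - (blockIter k x') μ).val ((blockIter k x') μ - (blockIter k x) μ).val)
  unfold HiggsLattice.Site.tdist
  rw [hμ]
  have hcoord := circ_scale_le (sitesPerDir_zero_eq' hk μ) hT (x μ) (x' μ)
    ((blockIter k x) μ) ((blockIter k x') μ) (val_blockIter_all k x μ) (val_blockIter_all k x' μ)
  have hle : min (x μ - x' μ).val (x' μ - x μ).val ≤
      Finset.univ.sup (fun ν : Fin P.d => min (x ν - x' ν).val (x' ν - x ν).val) :=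
    Finset.le_sup (f := fun ν : Fin P.d => min (x ν - x' ν).val (x' ν - x ν).val) (Finset.mem_univ μ)
  omega

/-- The same in real form, solved for the block-label distance: `|x_k − x′_k| ≤ |x − x′|/L^k + 1 − L^{−k}`.
[cite: Balaban1982Higgs1, (1.20) p.607] -/
theorem tdist_blockIter_le_real (hk : k ≤ P.K) (x x' : HiggsLattice.Site P 0) :
    (HiggsLattice.Site.tdist (blockIter k x) (blockIter k x') : ℝ) ≤
      (HiggsLattice.Site.tdist x x' : ℝ) / (P.L : ℝ) ^ k + 1 - (((P.L : ℝ) ^ k))⁻¹ := by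
  have hT : (0 : ℝ) < (P.L : ℝ) ^ k := pow_pos (by exact_mod_cast P.hL) k
  have h := mul_tdist_blockIter_le hk x x'
  have h1 : 1 ≤ P.L ^ k := Nat.one_le_pow _ _ P.hL
  have hcast : ((P.L ^ k : ℕ) : ℝ) * (HiggsLattice.Site.tdist (blockIter k x) (blockIter k x') : ℝ) ≤
      (HiggsLattice.Site.tdist x x' : ℝ) + (((P.L ^ k : ℕ) : ℝ) - 1) := by
    have := (Nat.cast_le (α := ℝ)).mpr h
    rw [Nat.cast_mul, Nat.cast_add, Nat.cast_sub h1, Nat.cast_one] at this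
    exact this
  rw [Nat.cast_pow] at hcast
  rw [div_add' _ _ _ hT.ne', le_sub_iff_add_le, le_div_iff₀ hT]
  nlinarith [inv_mul_cancel₀ hT.ne']

variable (C : ChargeData N) (A : HiggsLattice.VecField P 0) (G : Module.End ℝ (ScalarField P 0 N))

/-- **The printed shape of Corollary 2.3 implies the block form**: if `|⟨g, Gg′⟩| ≤ c₀e^{−δ₀R/L^k}‖g‖‖g′‖` whenever the
supports of `g`, `g′` are `≥ R` apart in `T_ε` (decay in `dist(supp g, supp g′)` measured in units of `T^{(k)}`, as in
[13] (2.30)), then for `g`, `g′` localised in `B^k(y)`, `B^k(y′)`: `|⟨g, Gg′⟩| ≤ c₀e^{δ₀}·e^{−δ₀|y − y′|}‖g‖‖g′‖` (`k ≤ K`).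
[cite: Balaban1983RegularityDecay, Cor. 2.3 (2.30) p.580] -/
theorem pairing_block_of_sep (hk : k ≤ P.K) {c₀ δ₀ : ℝ} (hc : 0 ≤ c₀) (hδ : 0 ≤ δ₀)
    (hSep : ∀ (R : ℝ) (g g' : ScalarField P 0 N),
      (∀ x x', g x ≠ 0 → g' x' ≠ 0 → R ≤ (HiggsLattice.Site.tdist x x' : ℝ)) →
        |siteInner g (G g')| ≤ c₀ * Real.exp (-(δ₀ * (R / (P.L : ℝ) ^ k))) *
          Real.sqrt (siteInner g g) * Real.sqrt (siteInner g' g'))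
    (y y' : HiggsLattice.Site P k) (g g' : ScalarField P 0 N)
    (hg : ∀ x, blockIter k x ≠ y → g x = 0) (hg' : ∀ x, blockIter k x ≠ y' → g' x = 0) :
    |siteInner g (G g')| ≤ c₀ * Real.exp δ₀ * Real.exp (-(δ₀ * (HiggsLattice.Site.tdist y y' : ℝ))) *
      Real.sqrt (siteInner g g) * Real.sqrt (siteInner g' g') := by
  have hT : (0 : ℝ) < (P.L : ℝ) ^ k := pow_pos (by exact_mod_cast P.hL) k
  set R : ℝ := (P.L : ℝ) ^ k * (HiggsLattice.Site.tdist y y' : ℝ) - ((P.L : ℝ) ^ k - 1) with hR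
  have hRle : ∀ x x', g x ≠ 0 → g' x' ≠ 0 → R ≤ (HiggsLattice.Site.tdist x x' : ℝ) := by
    intro x x' hx hx'
    have hy : blockIter k x = y := by
      by_contra h
      exact hx (hg x h)
    have hy' : blockIter k x' = y' := by
      by_contra h
      exact hx' (hg' x' h)
    have h := tdist_blockIter_le_real hk x x'
    rw [hy, hy'] at h
    rw [hR]
    have := mul_le_mul_of_nonneg_left h hT.le
    rw [mul_sub, mul_add, mul_one, mul_div_cancel₀ _ hT.ne', mul_inv_cancel₀ hT.ne'] at this
    linarith
  have h := hSep R g g' hRle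
  have hexp : Real.exp (-(δ₀ * (R / (P.L : ℝ) ^ k))) ≤
      Real.exp δ₀ * Real.exp (-(δ₀ * (HiggsLattice.Site.tdist y y' : ℝ))) := by
    rw [← Real.exp_add]
    apply Real.exp_le_exp.mpr
    rw [hR, sub_div, mul_div_cancel_left₀ _ hT.ne']
    have h1 : 0 ≤ δ₀ * (((P.L : ℝ) ^ k - 1) / (P.L : ℝ) ^ k) := by
      apply mul_nonneg hδ
      apply div_nonneg _ hT.le
      linarith [one_le_pow₀ (M₀ := ℝ) (a := (P.L : ℝ)) (by exact_mod_cast P.hL) (n := k)]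
    have h2 : δ₀ * (((P.L : ℝ) ^ k - 1) / (P.L : ℝ) ^ k) ≤ δ₀ := by
      have : ((P.L : ℝ) ^ k - 1) / (P.L : ℝ) ^ k ≤ 1 := by
        rw [div_le_one hT]; linarith
      nlinarith
    nlinarith
  have hn : 0 ≤ Real.sqrt (siteInner g g) * Real.sqrt (siteInner g' g') :=
    mul_nonneg (Real.sqrt_nonneg _) (Real.sqrt_nonneg _)
  calc |siteInner g (G g')|
      ≤ c₀ * Real.exp (-(δ₀ * (R / (P.L : ℝ) ^ k))) * Real.sqrt (siteInner g g) * Real.sqrt (siteInner g' g') := h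
    _ = c₀ * Real.exp (-(δ₀ * (R / (P.L : ℝ) ^ k))) * (Real.sqrt (siteInner g g) * Real.sqrt (siteInner g' g')) := by
        ring
    _ ≤ c₀ * (Real.exp δ₀ * Real.exp (-(δ₀ * (HiggsLattice.Site.tdist y y' : ℝ)))) *
          (Real.sqrt (siteInner g g) * Real.sqrt (siteInner g' g')) :=
        mul_le_mul_of_nonneg_right (mul_le_mul_of_nonneg_left hexp hc) hn
    _ = _ := by ring

end BlockGeometry

section ConcreteOfSep

variable (C : ChargeData N) (Ω : Finset (HiggsLattice.Site P 0)) (A : HiggsLattice.VecField P 0) (msq a : ℝ)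

/-- **(5.4) at level `k = j + 1 ≥ 1` FROM THE COROLLARY-2.3 SHAPE for `G^ε_k(Ω,A)`** (`HiggsCovariance.propagatorK`):
if `|⟨g, G^ε_k(Ω,A)g′⟩| ≤ c₀e^{−δ₀ dist(supp g, supp g′)/L^k}‖g‖‖g′‖` (distance (1.3) of `T_ε`, i.e. `dist` in units of
`T^{(k)}`), then the precision operator `a(L^{k+1}ε)^{−2}P(A) + Δ^{(k)}(Ω,A)` obeys (5.4) with
`c = a(L^{k+1}ε)^{−2}e^{δ₀(L−1)} + (a_k(L^kε)^{−2} + (a_k(L^kε)^{−2})²c₀e^{δ₀})` (`k < K`, `a ≥ 0`).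
[cite: Balaban1983RegularityDecay, (5.4) p.594] -/
theorem hker_precOpA_succ_of_sep {j : ℕ} (hj : j + 1 < P.K) (ha : 0 ≤ a) {c₀ δ₀ : ℝ} (hc : 0 ≤ c₀) (hδ : 0 ≤ δ₀)
    (hSep : ∀ (R : ℝ) (g g' : ScalarField P 0 N),
      (∀ x x', g x ≠ 0 → g' x' ≠ 0 → R ≤ (HiggsLattice.Site.tdist x x' : ℝ)) →
        |siteInner g (propagatorK C Ω A msq a (j + 1) g')| ≤
          c₀ * Real.exp (-(δ₀ * (R / (P.L : ℝ) ^ (j + 1)))) *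
            Real.sqrt (siteInner g g) * Real.sqrt (siteInner g' g'))
    (p q : HiggsLattice.Site P (j + 1) × Ix N) :
    |mat (precOpA C Ω A msq a (j + 1)) p q| ≤
      (a * ((P.mesh (j + 1 + 1))⁻¹ ^ 2) * Real.exp (δ₀ * ((P.L : ℝ) - 1)) +
          (|coeff221 P a (j + 1)| + coeff221 P a (j + 1) ^ 2 * (c₀ * Real.exp δ₀))) *
        Real.exp (-(δ₀ * (HiggsLattice.Site.tdist p.1 q.1 : ℝ))) :=
  hker_precOpA_of_deltaKA C A Ω msq a hj ha hδ
    (abs_mat_deltaKA_succ_le C A Ω msq a j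
      (abs_mat_QGQ_le C A (propagatorK C Ω A msq a (j + 1)) hj.le
        (pairing_block_of_sep (propagatorK C Ω A msq a (j + 1)) hj.le hc hδ hSep)))
    p q

/-- **(2.34) for the concrete `C^{(k)}_Λ(Ω,A)`, `k ≥ 1`, from (2.33)ₗ and the Corollary-2.3 shape for `G^ε_k(Ω,A)`** —
[13] p. 594 *"From these properties it follows that Proposition I.2.3 is a consequence of the following Theorem"*, with
the "properties" (5.4) now DERIVED from the pairing decay of `G^ε_k(Ω,A)` (the `P(A)`- and `Q_k`-bookkeeping of §4–§5);
constants `(cSt, dSt)(N·K_d; γ₀, c, δ₀)` with the `c` of `hker_precOpA_succ_of_sep` (`a > 0`, `k < K`) — independent of `Λ`, `Ω`, `A`.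
[cite: Balaban1982Higgs1, Prop. 2.3 (2.34) p.611] -/
theorem ineq234_concrete_of_sep {j : ℕ} (hj : j + 1 < P.K) (ha : 0 < a) {γ₀ c₀ δ₀ : ℝ} (hγ : 0 < γ₀) (hc : 0 ≤ c₀)
    (hδ : 0 < δ₀)
    (hlow : ∀ f : ScalarField P (j + 1) N, γ₀ * siteInner f f ≤ siteInner f (precOpA C Ω A msq a (j + 1) f))
    (hSep : ∀ (R : ℝ) (g g' : ScalarField P 0 N),
      (∀ x x', g x ≠ 0 → g' x' ≠ 0 → R ≤ (HiggsLattice.Site.tdist x x' : ℝ)) →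
        |siteInner g (propagatorK C Ω A msq a (j + 1) g')| ≤
          c₀ * Real.exp (-(δ₀ * (R / (P.L : ℝ) ^ (j + 1)))) *
            Real.sqrt (siteInner g g) * Real.sqrt (siteInner g' g'))
    (Λ : Finset (HiggsLattice.Site P (j + 1))) {p q : HiggsLattice.Site P (j + 1) × Ix N} (hp : p.1 ∈ Λ) (hq : q.1 ∈ Λ) :
    |mat (condCov232 C Ω A msq a (j + 1) Λ) p q| ≤
      cSt (profile P N) γ₀ (a * ((P.mesh (j + 1 + 1))⁻¹ ^ 2) * Real.exp (δ₀ * ((P.L : ℝ) - 1)) +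
          (|coeff221 P a (j + 1)| + coeff221 P a (j + 1) ^ 2 * (c₀ * Real.exp δ₀))) δ₀ *
        Real.exp (-(dSt (profile P N) γ₀ (a * ((P.mesh (j + 1 + 1))⁻¹ ^ 2) * Real.exp (δ₀ * ((P.L : ℝ) - 1)) +
          (|coeff221 P a (j + 1)| + coeff221 P a (j + 1) ^ 2 * (c₀ * Real.exp δ₀))) δ₀ *
          (HiggsLattice.Site.tdist p.1 q.1 : ℝ))) :=
  ineq234_concrete C Ω A msq a hγ
    (add_pos_of_pos_of_nonneg (mul_pos (mul_pos ha (pow_pos (inv_pos.mpr (P.mesh_pos _)) 2)) (Real.exp_pos _))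
      (add_nonneg (abs_nonneg _) (mul_nonneg (sq_nonneg _) (mul_nonneg hc (Real.exp_pos _).le))))
    hδ hlow (hker_precOpA_succ_of_sep C Ω A msq a hj ha.le hc hδ.le hSep) Λ hp hq

/-- **(2.36) for the concrete `δC^{(k)}_Λ(Ω,A)`, `k ≥ 1`, from the same inputs.** [cite: Balaban1982Higgs1, Prop. 2.3 (2.36) p.612] -/
theorem ineq236_concrete_of_sep {j : ℕ} (hj : j + 1 < P.K) (ha : 0 < a) {γ₀ c₀ δ₀ : ℝ} (hγ : 0 < γ₀) (hc : 0 ≤ c₀)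
    (hδ : 0 < δ₀)
    (hlow : ∀ f : ScalarField P (j + 1) N, γ₀ * siteInner f f ≤ siteInner f (precOpA C Ω A msq a (j + 1) f))
    (hSep : ∀ (R : ℝ) (g g' : ScalarField P 0 N),
      (∀ x x', g x ≠ 0 → g' x' ≠ 0 → R ≤ (HiggsLattice.Site.tdist x x' : ℝ)) →
        |siteInner g (propagatorK C Ω A msq a (j + 1) g')| ≤
          c₀ * Real.exp (-(δ₀ * (R / (P.L : ℝ) ^ (j + 1)))) *
            Real.sqrt (siteInner g g) * Real.sqrt (siteInner g' g'))
    (Λ : Finset (HiggsLattice.Site P (j + 1))) {p q : HiggsLattice.Site P (j + 1) × Ix N} (hp : p.1 ∈ Λ) (hq : q.1 ∈ Λ) :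
    |mat (deltaCov235 C Ω A msq a (j + 1) Λ) p q| ≤
      cSt (profile P N) γ₀ (a * ((P.mesh (j + 1 + 1))⁻¹ ^ 2) * Real.exp (δ₀ * ((P.L : ℝ) - 1)) +
          (|coeff221 P a (j + 1)| + coeff221 P a (j + 1) ^ 2 * (c₀ * Real.exp δ₀))) δ₀ *
        Real.exp (-(dSt (profile P N) γ₀ (a * ((P.mesh (j + 1 + 1))⁻¹ ^ 2) * Real.exp (δ₀ * ((P.L : ℝ) - 1)) +
          (|coeff221 P a (j + 1)| + coeff221 P a (j + 1) ^ 2 * (c₀ * Real.exp δ₀))) δ₀ *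
          ((HiggsLattice.Site.tdist p.1 q.1 : ℝ) + distC Λ p.1 + distC Λ q.1))) :=
  ineq236_concrete C Ω A msq a hγ
    (add_pos_of_pos_of_nonneg (mul_pos (mul_pos ha (pow_pos (inv_pos.mpr (P.mesh_pos _)) 2)) (Real.exp_pos _))
      (add_nonneg (abs_nonneg _) (mul_nonneg (sq_nonneg _) (mul_nonneg hc (Real.exp_pos _).le))))
    hδ hlow (hker_precOpA_succ_of_sep C Ω A msq a hj ha.le hc hδ.le hSep) Λ hp hq

end ConcreteOfSep


end

end Literature.MathematicalPhysics.QuantumFieldTheory.Balaban1983to89.B1Ineq234Concrete
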